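import Literature.Analysis.FluidPDE.NSEnstrophyPersistence
import Literature.Analysis.FluidPDE.ClassicalSolutionCalculus
import Literature.Analysis.FluidPDE.TaoForcedUniquenessSchwartzForce
import Literature.Analysis.FluidPDE.TaoForcedUniquenessApriori
import Literature.Analysis.FluidPDE.TaoForcedBoundedTotalSpeed
import HarnessLib

/-!
# The vorticity energy method for classical Navier–Stokes solutions WITH FORCE: persistence of
# `H^k` regularity (Tao 2013, Cor. 4.3 + Thm. 5.4 (iv) with the closing note of its proof, `f ≠ 0`)

Analysis/FluidPDE proof file (cell `pub/ns-blowup`, seat `ns-blowup-lit` g10; bears_on the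
Literature debt `tao2011_hasBoundedSobolevNormsOn_forced` of `TaoForcedBoundedSobolevNorms.lean`
and the analytic stub «forced local continuation» of the E–C route; WHAT THIS IS NOT: not a
statement about Navier–Stokes blow-up — regularity bookkeeping for classical solutions of the
FORCED system). No definitions, no named facts.

The tree proves persistence of regularity for classical solutions of the UNFORCED system by the
energy method for the differentiated vorticity equation (`CoordDerivatives` → `EnergyToolkit` →
`NSVorticityEnergy` → `NSVorticitySlice` → `NSEnstrophyPersistence`, discharging
`tao2011_hasBoundedSobolevNormsOn_of_memSobolevX`). This file is the FORCED twin of the last link: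

* §1 the differentiated vorticity equation WITH force,
  `∂ₜW − νΔW + (u·∇)W = −(Leibniz remainders) + ∂^β(∂ₖfᵢ − ∂ᵢfₖ)` for `W = ∂^βΩ_{ki}`
  (`IsClassicalNSSolutionOn.vorticity_transport_forced`; Majda–Bertozzi (1.33) with the curl of
  the force kept), and the pointwise bound for everything except the force term
  (`abs_vorticity_forcing_sub_force_le`);
* §2 the slice energy inequality WITH force: the abstract core inequality
  `slice_energy_inequality_core` of `NSVorticitySlice` is applied to `Ẇ − ∂^β(curl f)_{ki}`, and
  the force pairing `2∫χ⁴ W ∂^β(curl f)_{ki}` is bounded by `∫χ⁴|∇ⁿΩ|² + 4∫|∇^{n+1}f|²`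
  (`|∇ⁿ(curl f)|² ≤ 4|∇^{n+1}f|²`), so that the inequality keeps the shape
  `∂ₜX_R ≤ −νD_R + C₀(1 + X_R + Y_R)` with `C₀` now depending also on the slab bound
  `sup_t ∫|∇^{n+1}f(t)|²` (`IsClassicalNSSolutionOn.slice_energy_inequality_forced`);
* §3 Grönwall, exhaustion `R → ∞` and the induction on the level, verbatim as in the unforced
  file (`uniform_enstrophy_bounds_forced`, `sobolev_step_forced`, `sobolev_all_forced`);
* §4 the conclusion: a classical solution of the forced system on `[0, T] × ℝ³` (`ν > 0`) lying in
  `X¹([0,T] × ℝ³)` whose datum has all derivatives in `L²` and whose force has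
  `sup_{t ∈ [0,T]} ∫|Dᵐf(t)|² < ∞` for every `m` (Tao's smooth `L^∞_t H^k_x` forces, the class of
  the note closing the proof of Thm. 5.4) has all spatial Sobolev norms bounded on `[0, T]`
  (`IsClassicalNSSolutionOn.hasBoundedSobolevNormsOn_forced_of_memSobolevX`).

Combined with the tree's forced Cor. 11.1 (`memSobolevX_one_forced_of_totalSpeed`, seat lean2;
Prop. 9.1 and Lemma 8.1 with a Clay-class force, `totalSpeed_lt_top_of_clayForce`,
`dissipation_lt_top_of_clayForce`) this yields the spatial (`u`-) clause of the named fact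
`tao2011_hasBoundedSobolevNormsOn_forced` as a theorem, with NO pressure normalisation hypothesis
(`IsClassicalNSSolutionOn.hasBoundedSobolevNormsOn_of_clayForce`, §5): a finite energy classical
solution of the forced system on a closed slab with Schwartz datum and Clay-class force has
`u ∈ L^∞_t H^k_x([0,T] × ℝ³)` for every `k`.

## References

* T. Tao, *Localisation and compactness properties of the Navier–Stokes global regularity
  problem*, Anal. PDE 6 (2013) 25–107 = arXiv:1108.1165 (`Tao2011`): Cor. 11.1 (arXiv Cor. 68,
  p. 36) "Let `(u,p,u₀,f,T)` be an almost smooth finite energy solution with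
  `‖u₀‖_{H¹} + ‖f‖_{L^∞_t H¹_x} < ∞`. Then `u ∈ X¹`", Cor. 4.3, and Thm. 5.4 (iv) (arXiv Thm. 31,
  p. 18) with the note closing its proof: "it would have sufficed to have `u₀ ∈ H^k_x(ℝ³)` and
  `f ∈ C^j_t H^k_x(ℝ³)` for all `j, k ≥ 0`" — all printed WITH the forcing term.
* A. J. Majda, A. L. Bertozzi, *Vorticity and Incompressible Flow*, CUP (2002)
  (`MajdaBertozzi2002`), §1.4 (1.33) (vorticity equation), §3.2 Prop. 3.7 (the `H^m` energy
  estimate). [folklore]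
-/

noncomputable section

open MeasureTheory Set Function Filter
open scoped ENNReal NNReal ContDiff BigOperators Pointwise

namespace Literature.Analysis.FluidPDE

/-! ## §1 The differentiated vorticity equation WITH force -/

section Vorticity

variable {ι : Type*} [Fintype ι] [DecidableEq ι]
variable {S : Set ℝ} {ν : ℝ} {f u : ℝ → EuclideanSpace ℝ ι → EuclideanSpace ℝ ι}
  {p : ℝ → EuclideanSpace ℝ ι → ℝ}

/-- The forced momentum equation solved for `∂ₜuᵢ`, as an identity of functions of `x`:
`∂ₜuᵢ = ν ∑ⱼ ∂ⱼ∂ⱼuᵢ − ∂ᵢp − ∑ⱼ uⱼ∂ⱼuᵢ + fᵢ`. [cite: FeffermanClay2006, (1)] -/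
theorem IsClassicalNSSolutionOn.timeDerivWithin_comp_eq_forced (h : IsClassicalNSSolutionOn S ν f u p)
    (hS : UniqueDiffOn ℝ S) {t : ℝ} (ht : t ∈ S) (i : ι) :
    FluidPDE.timeDerivWithin S (fun s y => u s y i) t = fun x =>
      ν * ∑ j, pderiv j (pderiv j fun y => u t y i) x - pderiv i (p t) x -
        ∑ j, u t x j * pderiv j (fun y => u t y i) x + f t x i := by
  funext x
  have hm := h.momentum_comp hS ht x i
  linarith

omit [DecidableEq ι] in
/-- The slices `fᵢ(t, ·)` of the force of a classical solution are smooth (the equation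
determines the force, `IsClassicalNSSolutionOn.isSmoothSpaceTimeOn_force`). [cite: FeffermanClay2006, (1) and (6)] -/
theorem IsClassicalNSSolutionOn.contDiff_force_comp (h : IsClassicalNSSolutionOn S ν f u p)
    (hS : UniqueDiffOn ℝ S) {t : ℝ} (ht : t ∈ S) (i : ι) : ContDiff ℝ ∞ fun y => f t y i :=
  ((h.isSmoothSpaceTimeOn_force hS).euclidean_comp i).contDiff_slice ht

omit [DecidableEq ι] in
/-- The slices `f(t, ·)` of the force of a classical solution are smooth. [cite: FeffermanClay2006, (1) and (6)] -/
theorem IsClassicalNSSolutionOn.contDiff_force (h : IsClassicalNSSolutionOn S ν f u p)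
    (hS : UniqueDiffOn ℝ S) {t : ℝ} (ht : t ∈ S) : ContDiff ℝ ∞ (f t) :=
  (h.isSmoothSpaceTimeOn_force hS).contDiff_slice ht

/-- **The vorticity transport identity WITH force.** For a classical solution of the forced system
on a time set `S` of unique differentiability contained in the closure of its interior, `t ∈ S`,
a word `β` and indices `k, i`, the field `W = ∂^β Ω_{ki}` satisfies
`∂ₜW − ν ∑ⱼ ∂ⱼ∂ⱼW + ∑ⱼ uⱼ ∂ⱼW = −∑ⱼ (rem^{k::β}_{ij} − rem^{i::β}_{kj}) + ∂^β(∂ₖfᵢ − ∂ᵢfₖ)` with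
the Leibniz remainders `rem^{γ}_{ij} = ∂^γ(uⱼ ∂ⱼuᵢ) − uⱼ ∂^γ∂ⱼuᵢ`; the pressure drops out because
`∂ₖ∂^β∂ᵢp = ∂ᵢ∂^β∂ₖp`, the force survives through its curl (Majda–Bertozzi (1.33) with force,
differentiated `|β|` times). [cite: DoeringGibbon1995, §6.2 eq. (6.2.8) (p. 99); Majda–Bertozzi 2002 (1.33)] -/
theorem IsClassicalNSSolutionOn.vorticity_transport_forced (h : IsClassicalNSSolutionOn S ν f u p)
    (hS : UniqueDiffOn ℝ S) (hcl : S ⊆ closure (interior S)) {t : ℝ} (ht : t ∈ S)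
    (x : EuclideanSpace ℝ ι) {n : ℕ} (β : Fin n → ι) (k i : ι) :
    FluidPDE.timeDerivWithin S (fun s y => ipderiv β (vortComp (u s) k i) y) t x -
        ν * ∑ j, pderiv j (pderiv j (ipderiv β (vortComp (u t) k i))) x +
        ∑ j, u t x j * pderiv j (ipderiv β (vortComp (u t) k i)) x =
      -∑ j, ((ipderiv (Fin.cons k β : Fin (n + 1) → ι)
                (fun y => u t y j * pderiv j (fun z => u t z i) y) x -
              u t x j * ipderiv (Fin.cons k β : Fin (n + 1) → ι) (pderiv j fun z => u t z i) x) -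
            (ipderiv (Fin.cons i β : Fin (n + 1) → ι)
                (fun y => u t y j * pderiv j (fun z => u t z k) y) x -
              u t x j * ipderiv (Fin.cons i β : Fin (n + 1) → ι) (pderiv j fun z => u t z k) x)) +
        ipderiv β (vortComp (f t) k i) x := by
  -- smoothness of all the players
  have hu : ∀ {s}, s ∈ S → ContDiff ℝ ∞ (u s) := fun hs => h.contDiff_velocity hs
  have hU : ∀ j, ContDiff ℝ ∞ fun y => u t y j := fun j => contDiff_comp_of_contDiff (hu ht) j
  have hF : ∀ j, ContDiff ℝ ∞ fun y => f t y j := fun j => h.contDiff_force_comp hS ht j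
  have hP : ContDiff ℝ ∞ (p t) := h.contDiff_pressure ht
  have hdU : ∀ j l, ContDiff ℝ ∞ (pderiv l fun y => u t y j) := fun j l => contDiff_pderiv (hU j) l
  set γk : Fin (n + 1) → ι := Fin.cons k β with hγk
  set γi : Fin (n + 1) → ι := Fin.cons i β with hγi
  -- (A1) the time derivative through the words
  have hfield : ∀ s ∈ S, ∀ y, ipderiv β (vortComp (u s) k i) y =
      ipderiv γk (fun z => u s z i) y - ipderiv γi (fun z => u s z k) y :=
    fun s hs y => by rw [ipderiv_vortComp (hu hs), hγk, hγi, ipderiv_cons, ipderiv_cons]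
  have hsm : ∀ (γ : Fin (n + 1) → ι) (j : ι),
      IsSmoothSpaceTimeOn S (fun s y => ipderiv γ (fun z => u s z j) y) := fun γ j =>
    (h.isSmoothSpaceTimeOn_comp j).ipderiv_slice hS γ
  have hT : ∀ (γ : Fin (n + 1) → ι) (j : ι),
      FluidPDE.timeDerivWithin S (fun s y => ipderiv γ (fun z => u s z j) y) t x =
        ipderiv γ (FluidPDE.timeDerivWithin S (fun s y => u s y j) t) x := fun γ j =>
    (h.isSmoothSpaceTimeOn_comp j).timeDerivWithin_ipderiv_slice hS hcl γ ht x
  have hA1 : FluidPDE.timeDerivWithin S (fun s y => ipderiv β (vortComp (u s) k i) y) t x =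
      ipderiv γk (FluidPDE.timeDerivWithin S (fun s y => u s y i) t) x -
        ipderiv γi (FluidPDE.timeDerivWithin S (fun s y => u s y k) t) x := by
    rw [timeDerivWithin_congr_on hfield ht x, (hsm γk i).timeDerivWithin_fun_sub (hsm γi k) hS ht x,
      hT, hT]
  -- (A2)-(A3) expand `∂^γ (∂ₜ u_j)`
  have hA3 : ∀ (γ : Fin (n + 1) → ι) (j : ι),
      ipderiv γ (FluidPDE.timeDerivWithin S (fun s y => u s y j) t) x =
        ν * ∑ l, pderiv l (pderiv l (ipderiv γ fun y => u t y j)) x -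
          ipderiv γ (pderiv j (p t)) x -
          ∑ l, ipderiv γ (fun y => u t y l * pderiv l (fun z => u t z j) y) x +
          ipderiv γ (fun y => f t y j) x := by
    intro γ j
    rw [h.timeDerivWithin_comp_eq_forced hS ht j]
    have hAf : ContDiff ℝ ∞ fun y => ν * ∑ l, pderiv l (pderiv l fun z => u t z j) y :=
      contDiff_const.mul (ContDiff.sum fun l _ => contDiff_pderiv (hdU j l) l)
    have hBf : ContDiff ℝ ∞ (pderiv j (p t)) := contDiff_pderiv hP j
    have hCf : ContDiff ℝ ∞ fun y => ∑ l, u t y l * pderiv l (fun z => u t z j) y :=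
      ContDiff.sum fun l _ => (hU l).mul (hdU j l)
    have e0 := ipderiv_add ((hAf.sub hBf).sub hCf) (hF j) γ
    have e1 := ipderiv_sub (hAf.sub hBf) hCf γ
    have e2 := ipderiv_sub hAf hBf γ
    have e3 := ipderiv_const_mul (f := fun y => ∑ l, pderiv l (pderiv l fun z => u t z j) y)
      (ContDiff.sum fun l _ => contDiff_pderiv (hdU j l) l) ν γ
    have e4 := ipderiv_finset_sum Finset.univ (f := fun l y => pderiv l (pderiv l fun z => u t z j) y)
      (fun l => contDiff_pderiv (hdU j l) l) γ
    have e5 := ipderiv_finset_sum Finset.univ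
      (f := fun l y => u t y l * pderiv l (fun z => u t z j) y) (fun l => (hU l).mul (hdU j l)) γ
    simp only at e0 e1 e2 e3 e4 e5
    rw [e0]
    simp only
    rw [e1]
    simp only
    rw [e2]
    simp only
    rw [e3]
    simp only
    rw [e4, e5]
    simp only
    have e6 : ∀ l, ipderiv γ (pderiv l (pderiv l fun z => u t z j)) x =
        pderiv l (pderiv l (ipderiv γ fun y => u t y j)) x := fun l => by
      rw [ipderiv_pderiv (hdU j l), ipderiv_pderiv (hU j)]
    simp only [e6]
  -- (A4) the pressure terms cancel
  have hA4 : ipderiv γk (pderiv i (p t)) x = ipderiv γi (pderiv k (p t)) x := by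
    rw [hγk, hγi, ipderiv_cons, ipderiv_cons, ipderiv_pderiv hP, ipderiv_pderiv hP,
      pderiv_comm (contDiff_ipderiv hP β)]
  -- (A4') the force terms recombine into `∂^β (curl f)_{ki}`
  have hA4' : ipderiv γk (fun y => f t y i) x - ipderiv γi (fun y => f t y k) x =
      ipderiv β (vortComp (f t) k i) x := by
    rw [ipderiv_vortComp (h.contDiff_force hS ht), hγk, hγi, ipderiv_cons, ipderiv_cons]
  -- `W(t)` as a function of `x`, and its derivatives
  have hWfun : ipderiv β (vortComp (u t) k i) =
      fun y => ipderiv γk (fun z => u t z i) y - ipderiv γi (fun z => u t z k) y :=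
    funext (hfield t ht)
  have hdk : Differentiable ℝ (ipderiv γk fun z => u t z i) :=
    (contDiff_ipderiv (hU i) γk).differentiable (by simp)
  have hdi : Differentiable ℝ (ipderiv γi fun z => u t z k) :=
    (contDiff_ipderiv (hU k) γi).differentiable (by simp)
  have hW1 : ∀ l, pderiv l (ipderiv β (vortComp (u t) k i)) x =
      pderiv l (ipderiv γk fun z => u t z i) x - pderiv l (ipderiv γi fun z => u t z k) x := by
    intro l
    rw [hWfun, pderiv_sub hdk hdi]
  have hW2 : ∀ l, pderiv l (pderiv l (ipderiv β (vortComp (u t) k i))) x =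
      pderiv l (pderiv l (ipderiv γk fun z => u t z i)) x -
        pderiv l (pderiv l (ipderiv γi fun z => u t z k)) x := by
    intro l
    rw [hWfun, pderiv_sub hdk hdi, pderiv_sub]
    · exact (contDiff_pderiv (contDiff_ipderiv (hU i) γk) l).differentiable (by simp)
    · exact (contDiff_pderiv (contDiff_ipderiv (hU k) γi) l).differentiable (by simp)
  -- (A5) `∂^γ ∂ₗ = ∂ₗ ∂^γ` on the velocity components
  have hA5 : ∀ (γ : Fin (n + 1) → ι) (j l : ι),
      ipderiv γ (pderiv l fun z => u t z j) x = pderiv l (ipderiv γ fun z => u t z j) x := by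
    intro γ j l
    rw [ipderiv_pderiv (hU j)]
  -- (A6) assemble
  rw [hA1, hA3 γk i, hA3 γi k, hA4, ← hA4']
  simp only [hW1, hW2, hA5, mul_sub, Finset.sum_sub_distrib, Finset.mul_sum]
  ring

/-- **The vorticity forcing bound WITH force.** For a classical solution of the forced system and
`W = ∂^β Ω_{ki}`, `|β| = n`: everything in `∂ₜW − ν∑ⱼ∂ⱼ∂ⱼW + ∑ⱼuⱼ∂ⱼW` except the force term
`∂^β(curl f)_{ki}` is bounded pointwise by `2 (card ι) 2^{n+1} ∑_{a=1}^{n+1} |∇ᵃu| |∇^{n+2-a}u|`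
(all stretching/commutator terms are products `∇ᵃu ∇ᵇu` with `a + b = n + 2`, `a, b ≥ 1`).
[cite: DoeringGibbon1995, §6.2 eq. (6.2.8) (p. 99); Majda–Bertozzi 2002 (1.33)] -/
theorem IsClassicalNSSolutionOn.abs_vorticity_forcing_sub_force_le
    (h : IsClassicalNSSolutionOn S ν f u p) (hS : UniqueDiffOn ℝ S)
    (hcl : S ⊆ closure (interior S)) {t : ℝ} (ht : t ∈ S) (x : EuclideanSpace ℝ ι)
    {n : ℕ} (β : Fin n → ι) (k i : ι) :
    |(FluidPDE.timeDerivWithin S (fun s y => ipderiv β (vortComp (u s) k i) y) t x -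
          ipderiv β (vortComp (f t) k i) x) -
        ν * ∑ j, pderiv j (pderiv j (ipderiv β (vortComp (u t) k i))) x +
        ∑ j, u t x j * pderiv j (ipderiv β (vortComp (u t) k i)) x| ≤
      2 * Fintype.card ι * 2 ^ (n + 1) * ∑ a ∈ Finset.Icc 1 (n + 1),
        Real.sqrt (levelSq a (u t) x) * Real.sqrt (levelSq (n + 2 - a) (u t) x) := by
  have key := h.vorticity_transport_forced hS hcl ht x β k i
  have e : (FluidPDE.timeDerivWithin S (fun s y => ipderiv β (vortComp (u s) k i) y) t x -
          ipderiv β (vortComp (f t) k i) x) -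
        ν * ∑ j, pderiv j (pderiv j (ipderiv β (vortComp (u t) k i))) x +
        ∑ j, u t x j * pderiv j (ipderiv β (vortComp (u t) k i)) x =
      -∑ j, ((ipderiv (Fin.cons k β : Fin (n + 1) → ι)
                (fun y => u t y j * pderiv j (fun z => u t z i) y) x -
              u t x j * ipderiv (Fin.cons k β : Fin (n + 1) → ι) (pderiv j fun z => u t z i) x) -
            (ipderiv (Fin.cons i β : Fin (n + 1) → ι)
                (fun y => u t y j * pderiv j (fun z => u t z k) y) x -
              u t x j * ipderiv (Fin.cons i β : Fin (n + 1) → ι) (pderiv j fun z => u t z k) x)) := by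
    linarith
  rw [e, abs_neg]
  set B := ∑ a ∈ Finset.Icc 1 (n + 1),
    Real.sqrt (levelSq a (u t) x) * Real.sqrt (levelSq (n + 2 - a) (u t) x) with hB
  have hv := h.contDiff_velocity ht
  refine (Finset.abs_sum_le_sum_abs _ _).trans ?_
  calc ∑ j, |ipderiv (Fin.cons k β : Fin (n + 1) → ι)
              (fun y => u t y j * pderiv j (fun z => u t z i) y) x -
            u t x j * ipderiv (Fin.cons k β : Fin (n + 1) → ι) (pderiv j fun z => u t z i) x -
          (ipderiv (Fin.cons i β : Fin (n + 1) → ι)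
              (fun y => u t y j * pderiv j (fun z => u t z k) y) x -
            u t x j * ipderiv (Fin.cons i β : Fin (n + 1) → ι) (pderiv j fun z => u t z k) x)|
      ≤ ∑ _j : ι, (2 ^ (n + 1) * B + 2 ^ (n + 1) * B) := Finset.sum_le_sum fun j _ =>
        (abs_sub _ _).trans (add_le_add (abs_transport_remainder_le hv _ i j x)
          (abs_transport_remainder_le hv _ k j x))
    _ = 2 * Fintype.card ι * 2 ^ (n + 1) * B := by
        rw [Finset.sum_const, Finset.card_univ, nsmul_eq_mul]
        ring

end Vorticity


/-! ## §2 The slice energy inequality WITH force -/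

section Solution

variable {T ν : ℝ} {f u : ℝ → EuclideanSpace ℝ (Fin 3) → EuclideanSpace ℝ (Fin 3)}
  {p : ℝ → EuclideanSpace ℝ (Fin 3) → ℝ}

/-- The fields `(t, x) ↦ ∂^γ uᵢ (t, x)` are jointly smooth on `[0, T] × ℝ³` (any force).
[folklore] -/
private theorem IsClassicalNSSolutionOn.isSmoothSpaceTimeOn_levelFam_forced
    (h : IsClassicalNSSolutionOn (Icc 0 T) ν f u p) (hT : 0 < T) (m : ℕ)
    (c : (Fin m → Fin 3) × Fin 3) :
    IsSmoothSpaceTimeOn (Icc 0 T) fun t x => levelFam m (u t) c x :=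
  (h.isSmoothSpaceTimeOn_comp c.2).ipderiv_slice (uniqueDiffOn_Icc hT) c.1

/-- The fields `(t, x) ↦ ∂^β Ω_{ki} (t, x)` are jointly smooth on `[0, T] × ℝ³` (any force).
[folklore] -/
private theorem IsClassicalNSSolutionOn.isSmoothSpaceTimeOn_vortFam_forced
    (h : IsClassicalNSSolutionOn (Icc 0 T) ν f u p) (hT : 0 < T) (n : ℕ)
    (c : (Fin n → Fin 3) × Fin 3 × Fin 3) :
    IsSmoothSpaceTimeOn (Icc 0 T) fun t x => vortFam n (u t) c x := by
  have hU := uniqueDiffOn_Icc hT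
  have h1 : IsSmoothSpaceTimeOn (Icc 0 T) fun t x => vortComp (u t) c.2.1 c.2.2 x :=
    ((h.isSmoothSpaceTimeOn_comp c.2.2).pderiv_slice hU c.2.1).sub
      ((h.isSmoothSpaceTimeOn_comp c.2.1).pderiv_slice hU c.2.2)
  exact h1.ipderiv_slice hU c.1

/-- Joint continuity of `(t, x) ↦ |∇ᵐ u (t, x)|²` on `[0, T] × ℝ³` (any force). [folklore] -/
private theorem IsClassicalNSSolutionOn.continuousOn_levelSq_forced
    (h : IsClassicalNSSolutionOn (Icc 0 T) ν f u p) (hT : 0 < T) (m : ℕ) :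
    ContinuousOn (fun z : ℝ × (EuclideanSpace ℝ (Fin 3)) => levelSq m (u z.1) z.2)
      (Icc 0 T ×ˢ univ) := by
  have e : (fun z : ℝ × (EuclideanSpace ℝ (Fin 3)) => levelSq m (u z.1) z.2) =
      fun z => ∑ c : (Fin m → Fin 3) × Fin 3, (levelFam m (u z.1) c z.2) ^ 2 := by
    funext z
    rw [sum_sq_levelFam]
  rw [e]
  exact continuousOn_finsetSum _ fun c _ =>
    ((h.isSmoothSpaceTimeOn_levelFam_forced hT m c).continuousOn).pow 2

/-- Joint continuity of `(t, x) ↦ |∇ⁿ Ω (t, x)|²` on `[0, T] × ℝ³` (any force). [folklore] -/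
private theorem IsClassicalNSSolutionOn.continuousOn_vortSq_forced
    (h : IsClassicalNSSolutionOn (Icc 0 T) ν f u p) (hT : 0 < T) (n : ℕ) :
    ContinuousOn (fun z : ℝ × (EuclideanSpace ℝ (Fin 3)) => vortSq n (u z.1) z.2)
      (Icc 0 T ×ˢ univ) := by
  have e : (fun z : ℝ × (EuclideanSpace ℝ (Fin 3)) => vortSq n (u z.1) z.2) =
      fun z => ∑ c : (Fin n → Fin 3) × Fin 3 × Fin 3, (vortFam n (u z.1) c z.2) ^ 2 := by
    funext z
    rw [sum_sq_vortFam]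
  rw [e]
  exact continuousOn_finsetSum _ fun c _ =>
    ((h.isSmoothSpaceTimeOn_vortFam_forced hT n c).continuousOn).pow 2

/-- Continuity in time of the localised integrals `t ↦ ∫ χʲ |∇ᵐ u(t)|²` (any force). [folklore] -/
private theorem IsClassicalNSSolutionOn.continuousOn_integral_cutoff_pow_mul_levelSq_forced
    (h : IsClassicalNSSolutionOn (Icc 0 T) ν f u p) (hT : 0 < T) {R : ℝ} (hR : 0 < R)
    (j m : ℕ) (hj : j ≠ 0) :
    ContinuousOn (fun t => ∫ x, cutoff R x ^ j * levelSq m (u t) x) (Icc 0 T) :=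
  continuousOn_integral_mul_of_continuousOn
    (((contDiff_cutoff (n := 0) R).continuous.pow j) :
      Continuous fun x : (EuclideanSpace ℝ (Fin 3)) => cutoff R x ^ j)
    (hasCompactSupport_pow (hasCompactSupport_cutoff (E := (EuclideanSpace ℝ (Fin 3))) hR) hj)
    (h.continuousOn_levelSq_forced hT m)

/-- Continuity in time of the localised integrals `t ↦ ∫ χʲ |∇ⁿ Ω(t)|²` (any force). [folklore] -/
private theorem IsClassicalNSSolutionOn.continuousOn_integral_cutoff_pow_mul_vortSq_forced
    (h : IsClassicalNSSolutionOn (Icc 0 T) ν f u p) (hT : 0 < T) {R : ℝ} (hR : 0 < R)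
    (j n : ℕ) (hj : j ≠ 0) :
    ContinuousOn (fun t => ∫ x, cutoff R x ^ j * vortSq n (u t) x) (Icc 0 T) :=
  continuousOn_integral_mul_of_continuousOn
    (((contDiff_cutoff (n := 0) R).continuous.pow j) :
      Continuous fun x : (EuclideanSpace ℝ (Fin 3)) => cutoff R x ^ j)
    (hasCompactSupport_pow (hasCompactSupport_cutoff (E := (EuclideanSpace ℝ (Fin 3))) hR) hj)
    (h.continuousOn_vortSq_forced hT n)

/-- Continuity in time of the pairings `t ↦ ∫ χ⁴ ∂ₜW_c W_c` (any force). [folklore] -/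
private theorem IsClassicalNSSolutionOn.continuousOn_integral_cutoff_pow_mul_timeDerivWithin_mul_forced
    (h : IsClassicalNSSolutionOn (Icc 0 T) ν f u p) (hT : 0 < T) {R : ℝ} (hR : 0 < R)
    (n : ℕ) (c : (Fin n → Fin 3) × Fin 3 × Fin 3) :
    ContinuousOn (fun t => ∫ x, cutoff R x ^ 4 *
      (FluidPDE.timeDerivWithin (Icc 0 T) (fun s y => vortFam n (u s) c y) t x *
        vortFam n (u t) c x)) (Icc 0 T) := by
  have hW := h.isSmoothSpaceTimeOn_vortFam_forced hT n c
  have hWt := hW.timeDerivWithin (uniqueDiffOn_Icc hT)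
  exact continuousOn_integral_mul_of_continuousOn ((contDiff_cutoff (n := 0) R).continuous.pow 4)
    (hasCompactSupport_pow (hasCompactSupport_cutoff hR) (by norm_num))
    (hWt.continuousOn.mul hW.continuousOn)

/-- **The force pairing.** For smooth `v`, `g` on `ℝ³` and `R > 0`:
`∑_{(β,k,i)} 2 ∫ χ_R⁴ ∂^β(curl g)_{ki} ∂^βΩ_{ki}(v) ≤ ∫ χ_R⁴ |∇ⁿΩ(v)|² + 4 ∫ |∇^{n+1} g|²`
(`2ab ≤ a² + b²`, `χ_R⁴ ≤ 1` and `|∇ⁿ(curl g)|² ≤ 4 |∇^{n+1}g|²`). [folklore] -/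
private theorem sum_integral_cutoff_force_pairing_le
    {v g : EuclideanSpace ℝ (Fin 3) → EuclideanSpace ℝ (Fin 3)} (hv : ContDiff ℝ ∞ v)
    (hg : ContDiff ℝ ∞ g) {R : ℝ} (hR : 0 < R) (n : ℕ) (hgi : Integrable (levelSq (n + 1) g)) :
    ∑ c', 2 * ∫ x, cutoff R x ^ 4 * (vortFam n g c' x * vortFam n v c' x) ≤
      (∫ x, cutoff R x ^ 4 * vortSq n v x) + 4 * ∫ x, levelSq (n + 1) g x := by
  have hχc : Continuous (cutoff (E := (EuclideanSpace ℝ (Fin 3))) R) :=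
    (contDiff_cutoff (n := 0) R).continuous
  have hχs : HasCompactSupport (cutoff (E := (EuclideanSpace ℝ (Fin 3))) R) :=
    hasCompactSupport_cutoff hR
  have cG : ∀ c', Continuous (vortFam n g c') := fun c' => (contDiff_vortFam hg n c').continuous
  have cW : ∀ c', Continuous (vortFam n v c') := fun c' => (contDiff_vortFam hv n c').continuous
  have iGW : ∀ c', Integrable fun x => cutoff R x ^ 4 * (vortFam n g c' x * vortFam n v c' x) :=
    fun c' => integrable_pow_mul_of_continuous hχc hχs ((cG c').mul (cW c')) (by norm_num)
  have iG : ∀ c', Integrable fun x => cutoff R x ^ 4 * vortFam n g c' x ^ 2 := fun c' =>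
    integrable_pow_mul_of_continuous hχc hχs ((cG c').pow 2) (by norm_num)
  have iW : ∀ c', Integrable fun x => cutoff R x ^ 4 * vortFam n v c' x ^ 2 := fun c' =>
    integrable_pow_mul_of_continuous hχc hχs ((cW c').pow 2) (by norm_num)
  -- `2ab ≤ a² + b²` under the integral
  have hc' : ∀ c', 2 * ∫ x, cutoff R x ^ 4 * (vortFam n g c' x * vortFam n v c' x) ≤
      (∫ x, cutoff R x ^ 4 * vortFam n g c' x ^ 2) + ∫ x, cutoff R x ^ 4 * vortFam n v c' x ^ 2 := by
    intro c'
    rw [← integral_const_mul, ← integral_add (iG c') (iW c')]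
    refine integral_mono ((iGW c').const_mul 2) ((iG c').add (iW c')) fun x => ?_
    have h4 : 0 ≤ cutoff R x ^ 4 := pow_nonneg (cutoff_nonneg R x) 4
    nlinarith [sq_nonneg (vortFam n g c' x - vortFam n v c' x), h4,
      mul_nonneg h4 (sq_nonneg (vortFam n g c' x - vortFam n v c' x))]
  have hsum := Finset.sum_le_sum fun c' (_ : c' ∈ Finset.univ) => hc' c'
  rw [Finset.sum_add_distrib, sum_integral_cutoff_pow_mul_vortFam_sq hg hR n (j := 4) (by norm_num),
    sum_integral_cutoff_pow_mul_vortFam_sq hv hR n (j := 4) (by norm_num)] at hsum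
  -- `∫ χ⁴ |∇ⁿΩ(g)|² ≤ 4 ∫ |∇^{n+1} g|²`
  have hvort : Integrable (vortSq n g) := by
    refine (hgi.const_mul 4).mono' (continuous_vortSq hg n).aestronglyMeasurable
      (Eventually.of_forall fun x => ?_)
    rw [Real.norm_of_nonneg (vortSq_nonneg n _ x)]
    exact vortSq_le_four_mul_levelSq_succ hg n x
  have hG4 : ∫ x, cutoff R x ^ 4 * vortSq n g x ≤ 4 * ∫ x, levelSq (n + 1) g x := by
    calc ∫ x, cutoff R x ^ 4 * vortSq n g x ≤ ∫ x, vortSq n g x :=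
          integral_pow_mul_le_integral (continuous_vortSq hg n) (vortSq_nonneg n _) hvort
            (contDiff_cutoff (E := (EuclideanSpace ℝ (Fin 3))) R)
            (hasCompactSupport_cutoff (E := (EuclideanSpace ℝ (Fin 3))) hR)
            (cutoff_nonneg R) (cutoff_le_one R) (by norm_num)
      _ ≤ ∫ x, 4 * levelSq (n + 1) g x :=
          integral_mono hvort (hgi.const_mul 4) fun x => vortSq_le_four_mul_levelSq_succ hg n x
      _ = 4 * ∫ x, levelSq (n + 1) g x := integral_const_mul _ _
  linarith

/-- **The slice energy inequality for classical solutions of the FORCED system.** For a classical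
solution of the forced system on `[0, T] × ℝ³` (`ν > 0`), `n ≥ 1`, nonnegative constants `S m` and
a nonnegative constant `F`, there is `C₀` such that for all `R ≥ 1` and all `t ∈ [0, T]` at which
`∫ |∇ᵐu(t)|² ≤ S m` for `m ≤ n` and `∫ |∇^{n+1}f(t)|² ≤ F`:
`∑ 2 ∫ χ_R⁴ ∂ₜ(∂^βΩ_{ki}) ∂^βΩ_{ki} ≤ −ν ∫ χ_R⁴ |∇^{n+1}Ω|² + C₀ (1 + ∫ χ_R⁴ |∇ⁿΩ|² + ∫ χ_R² |∇^{n+1}u|²)`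
(the core inequality of `NSVorticitySlice` with `v = u(t)`, `Ẇ = ∂ₜ∂^βΩ_{ki} − ∂^β(curl f)_{ki}`
bounded by `abs_vorticity_forcing_sub_force_le`, `φ = χ_R`, `φ' = χ_{2R}`, plus the force pairing
`sum_integral_cutoff_force_pairing_le`; `C₀ = C₀^{core} + 1 + 4F`). [cite: DoeringGibbon1995, §6.2 Thm. 6.1 with eq. (6.2.8) (p. 99)] -/
theorem IsClassicalNSSolutionOn.slice_energy_inequality_forced
    (h : IsClassicalNSSolutionOn (Icc 0 T) ν f u p) (hν : 0 < ν) (hT : 0 < T) {n : ℕ}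
    (hn : 1 ≤ n) (S : ℕ → ℝ) (hS : ∀ m, 0 ≤ S m) {F : ℝ} (hF : 0 ≤ F) :
    ∃ C₀ : ℝ, 0 ≤ C₀ ∧ ∀ R : ℝ, 1 ≤ R → ∀ t ∈ Icc 0 T,
      (∀ m ≤ n, Integrable (levelSq m (u t))) → (∀ m ≤ n, ∫ x, levelSq m (u t) x ≤ S m) →
      Integrable (levelSq (n + 1) (f t)) → ∫ x, levelSq (n + 1) (f t) x ≤ F →
      ∑ c', 2 * ∫ x, cutoff R x ^ 4 *
          (FluidPDE.timeDerivWithin (Icc 0 T) (fun s y => vortFam n (u s) c' y) t x *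
            vortFam n (u t) c' x) ≤
        -ν * (∫ x, cutoff R x ^ 4 * vortSq (n + 1) (u t) x) +
          C₀ * (1 + (∫ x, cutoff R x ^ 4 * vortSq n (u t) x) +
            ∫ x, cutoff R x ^ 2 * levelSq (n + 1) (u t) x) := by
  obtain ⟨c, hc0, hc⟩ := exists_norm_fderiv_cutoff_le (E := (EuclideanSpace ℝ (Fin 3)))
  have hCF : (0 : ℝ) ≤ 2 * 3 * 2 ^ (n + 1) := by positivity
  obtain ⟨C₀, hC₀0, hC₀⟩ := slice_energy_inequality_core hν hc0 hCF hn S hS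
  refine ⟨C₀ + 1 + 4 * F, by positivity, fun R hR t ht hint hSv hfi hfF => ?_⟩
  have hR0 : 0 < R := by linarith
  have hU := uniqueDiffOn_Icc hT
  have hcl := Icc_subset_closure_interior hT
  have hv : ContDiff ℝ ∞ (u t) := h.contDiff_velocity ht
  have hg : ContDiff ℝ ∞ (f t) := h.contDiff_force hU ht
  have hdiv : ∀ x, ∑ i, pderiv i (fun y => u t y i) x = 0 := fun x => h.sum_pderiv_comp_eq_zero ht x
  -- the cutoffs
  have hgrad : ∀ {R'}, 1 ≤ R' → ∀ x, ‖fderiv ℝ (cutoff R') x‖ ≤ c := fun {R'} hR' x =>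
    (hc R' (by linarith) x).trans (div_le_self hc0 hR')
  -- the time derivatives, with the force term subtracted
  have hWtc : ∀ c', Continuous fun x =>
      FluidPDE.timeDerivWithin (Icc 0 T) (fun s y => vortFam n (u s) c' y) t x := fun c' =>
    (((h.isSmoothSpaceTimeOn_vortFam_forced hT n c').timeDerivWithin hU).contDiff_slice ht).continuous
  have hGc : ∀ c', Continuous (vortFam n (f t) c') := fun c' => (contDiff_vortFam hg n c').continuous
  have hWc : ∀ c', Continuous fun x =>
      FluidPDE.timeDerivWithin (Icc 0 T) (fun s y => vortFam n (u s) c' y) t x - vortFam n (f t) c' x :=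
    fun c' => (hWtc c').sub (hGc c')
  have hforce : ∀ c' x,
      |(FluidPDE.timeDerivWithin (Icc 0 T) (fun s y => vortFam n (u s) c' y) t x - vortFam n (f t) c' x) -
        ν * ∑ j, pderiv j (pderiv j (vortFam n (u t) c')) x +
        ∑ j, u t x j * pderiv j (vortFam n (u t) c') x| ≤
      2 * 3 * 2 ^ (n + 1) * ∑ a ∈ Finset.Icc 1 (n + 1),
        Real.sqrt (levelSq a (u t) x) * Real.sqrt (levelSq (n + 2 - a) (u t) x) := by
    intro c' x
    have := h.abs_vorticity_forcing_sub_force_le hU hcl ht x c'.1 c'.2.1 c'.2.2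
    rw [Fintype.card_fin] at this
    push_cast at this
    exact this
  have hcore := hC₀ (u t) (cutoff R) (cutoff (2 * R)) _ hv hdiv (contDiff_cutoff R)
    (hasCompactSupport_cutoff hR0) (cutoff_nonneg R) (cutoff_le_one R) (hgrad hR)
    (contDiff_cutoff (2 * R)) (hasCompactSupport_cutoff (by linarith)) (cutoff_nonneg (2 * R))
    (cutoff_le_one (2 * R)) (hgrad (by linarith)) (fun x hx => cutoff_two_mul_eq_one_of_ne hR0 hx)
    hWc hforce hint hSv
  -- the force pairing
  have hpair := sum_integral_cutoff_force_pairing_le hv hg hR0 n hfi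
  -- split `Ẇ W = (Ẇ − G) W + G W` under the integrals
  have hχc : Continuous (cutoff (E := (EuclideanSpace ℝ (Fin 3))) R) :=
    (contDiff_cutoff (n := 0) R).continuous
  have hχs : HasCompactSupport (cutoff (E := (EuclideanSpace ℝ (Fin 3))) R) :=
    hasCompactSupport_cutoff hR0
  have cW : ∀ c', Continuous (vortFam n (u t) c') := fun c' => (contDiff_vortFam hv n c').continuous
  have hsplit : ∀ c', ∫ x, cutoff R x ^ 4 *
      (FluidPDE.timeDerivWithin (Icc 0 T) (fun s y => vortFam n (u s) c' y) t x * vortFam n (u t) c' x) =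
      (∫ x, cutoff R x ^ 4 *
        ((FluidPDE.timeDerivWithin (Icc 0 T) (fun s y => vortFam n (u s) c' y) t x -
          vortFam n (f t) c' x) * vortFam n (u t) c' x)) +
      ∫ x, cutoff R x ^ 4 * (vortFam n (f t) c' x * vortFam n (u t) c' x) := by
    intro c'
    have i1 : Integrable fun x => cutoff R x ^ 4 *
        ((FluidPDE.timeDerivWithin (Icc 0 T) (fun s y => vortFam n (u s) c' y) t x -
          vortFam n (f t) c' x) * vortFam n (u t) c' x) :=
      integrable_pow_mul_of_continuous hχc hχs ((hWc c').mul (cW c')) (by norm_num)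
    have i2 : Integrable fun x => cutoff R x ^ 4 * (vortFam n (f t) c' x * vortFam n (u t) c' x) :=
      integrable_pow_mul_of_continuous hχc hχs ((hGc c').mul (cW c')) (by norm_num)
    rw [← integral_add i1 i2]
    refine integral_congr_ae (Eventually.of_forall fun x => ?_)
    simp only
    ring
  have hX0 : 0 ≤ ∫ x, cutoff R x ^ 4 * vortSq n (u t) x :=
    integral_nonneg fun x => mul_nonneg (pow_nonneg (cutoff_nonneg _ _) 4) (vortSq_nonneg _ _ _)
  have hY0 : 0 ≤ ∫ x, cutoff R x ^ 2 * levelSq (n + 1) (u t) x :=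
    integral_nonneg fun x => mul_nonneg (sq_nonneg _) (levelSq_nonneg _ _ _)
  have hsumeq : ∑ c', 2 * ∫ x, cutoff R x ^ 4 *
      (FluidPDE.timeDerivWithin (Icc 0 T) (fun s y => vortFam n (u s) c' y) t x * vortFam n (u t) c' x) =
      (∑ c', 2 * ∫ x, cutoff R x ^ 4 *
        ((FluidPDE.timeDerivWithin (Icc 0 T) (fun s y => vortFam n (u s) c' y) t x -
          vortFam n (f t) c' x) * vortFam n (u t) c' x)) +
      ∑ c', 2 * ∫ x, cutoff R x ^ 4 * (vortFam n (f t) c' x * vortFam n (u t) c' x) := by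
    rw [← Finset.sum_add_distrib]
    exact Finset.sum_congr rfl fun c' _ => by rw [hsplit c']; ring
  rw [hsumeq]
  have hF' : ∫ x, levelSq (n + 1) (f t) x ≤ F := hfF
  nlinarith [hcore, hpair, hX0, hY0, hF', hC₀0, hF]

/-! ## §3 Time integration, Grönwall, exhaustion and the induction (verbatim twins) -/

/-- **The localised enstrophy identity in time** (any force): for `t ∈ [0, T]`,
`∫ χ_R⁴ |∇ⁿΩ(t)|² − ∫ χ_R⁴ |∇ⁿΩ(0)|² = ∫₀ᵗ ∑ 2 ∫ χ_R⁴ ∂ₜ(∂^βΩ_{ki}) ∂^βΩ_{ki}`. [folklore] -/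
private theorem IsClassicalNSSolutionOn.integral_cutoff_vortSq_sub_eq_forced
    (h : IsClassicalNSSolutionOn (Icc 0 T) ν f u p) (hT : 0 < T) {R : ℝ} (hR : 0 < R) (n : ℕ)
    {t : ℝ} (ht : t ∈ Icc 0 T) :
    (∫ x, cutoff R x ^ 4 * vortSq n (u t) x) - ∫ x, cutoff R x ^ 4 * vortSq n (u 0) x =
      ∫ τ in Ioo 0 t, ∑ c', 2 * ∫ x, cutoff R x ^ 4 *
        (FluidPDE.timeDerivWithin (Icc 0 T) (fun s y => vortFam n (u s) c' y) τ x *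
          vortFam n (u τ) c' x) := by
  have hφc : Continuous fun x : (EuclideanSpace ℝ (Fin 3)) => cutoff R x ^ 4 :=
    (contDiff_cutoff (n := 0) R).continuous.pow 4
  have hφs : HasCompactSupport fun x : (EuclideanSpace ℝ (Fin 3)) => cutoff R x ^ 4 :=
    hasCompactSupport_pow (hasCompactSupport_cutoff hR) (by norm_num)
  have hE2 : ∀ c', ∫ τ in Ioo 0 t, ∫ x, cutoff R x ^ 4 *
      (FluidPDE.timeDerivWithin (Icc 0 T) (fun s y => vortFam n (u s) c' y) τ x * vortFam n (u τ) c' x) =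
      2⁻¹ * (∫ x, cutoff R x ^ 4 * vortFam n (u t) c' x ^ 2) -
        2⁻¹ * (∫ x, cutoff R x ^ 4 * vortFam n (u 0) c' x ^ 2) := fun c' =>
    (h.isSmoothSpaceTimeOn_vortFam_forced hT n c').integral_Ioo_integral_mul_timeDerivWithin_mul hT hφc
      hφs le_rfl ht.1 ht.2
  have hIo : ∀ c', IntegrableOn (fun τ => ∫ x, cutoff R x ^ 4 *
      (FluidPDE.timeDerivWithin (Icc 0 T) (fun s y => vortFam n (u s) c' y) τ x * vortFam n (u τ) c' x))
      (Ioo 0 t) := fun c' =>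
    integrableOn_Ioo_of_continuousOn
      (h.continuousOn_integral_cutoff_pow_mul_timeDerivWithin_mul_forced hT hR n c') ht
  rw [integral_finsetSum _ fun c' _ => (hIo c').const_mul 2]
  simp only [integral_const_mul, hE2]
  rw [← sum_integral_cutoff_pow_mul_vortFam_sq (h.contDiff_velocity ht) hR n (j := 4) (by norm_num),
    ← sum_integral_cutoff_pow_mul_vortFam_sq (h.contDiff_velocity ⟨le_rfl, hT.le⟩) hR n (j := 4)
      (by norm_num), ← Finset.sum_sub_distrib]
  exact Finset.sum_congr rfl fun c' _ => by ring

/-- **Uniform localised bounds (Grönwall), forced.** For a classical solution of the forced system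
on `[0, T] × ℝ³`, `ν > 0`, `n ≥ 1`: if `∫ |∇ᵐu(t)|² ≤ S m` for `m ≤ n` and
`∫ |∇^{n+1}f(t)|² ≤ F` for `t ∈ [0, T]`, the localised `L²_t`-norms `∫₀ᵀ ∫ χ_R² |∇^{n+1}u|²` are
bounded by `I` uniformly in `R ≥ 1`, and `∫ χ_R⁴ |∇ⁿΩ(0)|² ≤ X₀`, then `∫ χ_R⁴ |∇ⁿΩ(t)|²` and
`∫₀ᵀ ∫ χ_R⁴ |∇^{n+1}Ω|²` are bounded uniformly in `R ≥ 1`, `t ∈ [0, T]`. [cite: DoeringGibbon1995, §6.2 Thm. 6.1 with eq. (6.2.8) (p. 99)] -/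
theorem IsClassicalNSSolutionOn.uniform_enstrophy_bounds_forced
    (h : IsClassicalNSSolutionOn (Icc 0 T) ν f u p) (hν : 0 < ν) (hT : 0 < T) {n : ℕ}
    (hn : 1 ≤ n) (S : ℕ → ℝ) (hS : ∀ m, 0 ≤ S m)
    (hPS : ∀ m ≤ n, ∀ t ∈ Icc 0 T, Integrable (levelSq m (u t)) ∧ ∫ x, levelSq m (u t) x ≤ S m)
    {F : ℝ} (hF : 0 ≤ F)
    (hPF : ∀ t ∈ Icc 0 T, Integrable (levelSq (n + 1) (f t)) ∧ ∫ x, levelSq (n + 1) (f t) x ≤ F)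
    {I : ℝ} (hPI : ∀ R, 1 ≤ R → ∫ τ in Ioo 0 T, ∫ x, cutoff R x ^ 2 * levelSq (n + 1) (u τ) x ≤ I)
    {X₀ : ℝ} (hX₀ : ∀ R, 1 ≤ R → ∫ x, cutoff R x ^ 4 * vortSq n (u 0) x ≤ X₀) :
    ∃ M : ℝ, ∀ R, 1 ≤ R →
      (∀ t ∈ Icc 0 T, ∫ x, cutoff R x ^ 4 * vortSq n (u t) x ≤ M) ∧
        ∫ τ in Ioo 0 T, ∫ x, cutoff R x ^ 4 * vortSq (n + 1) (u τ) x ≤ M := by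
  obtain ⟨C₀, hC₀0, hC₀⟩ := h.slice_energy_inequality_forced hν hT hn S hS hF
  -- `I ≥ 0` and `X₀ ≥ 0`
  have hI0 : 0 ≤ I := (setIntegral_nonneg measurableSet_Ioo fun τ _ =>
    integral_nonneg fun x => mul_nonneg (sq_nonneg _) (levelSq_nonneg _ _ _)).trans (hPI 1 le_rfl)
  have hX₀0 : 0 ≤ X₀ := (integral_nonneg fun x =>
    mul_nonneg (pow_nonneg (cutoff_nonneg _ _) 4) (vortSq_nonneg _ _ _)).trans (hX₀ 1 le_rfl)
  set A : ℝ := X₀ + C₀ * T + C₀ * I with hA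
  have hA0 : 0 ≤ A := by positivity
  set M₁ : ℝ := A * Real.exp (C₀ * T) with hM₁
  have hM₁0 : 0 ≤ M₁ := by positivity
  refine ⟨max M₁ ((A + C₀ * (T * M₁)) / ν), fun R hR => ?_⟩
  have hR0 : 0 < R := by linarith
  have h0T : (0 : ℝ) ∈ Icc 0 T := ⟨le_rfl, hT.le⟩
  -- the four functions of time (opaque, with defining equations)
  obtain ⟨X, hX⟩ : ∃ X : ℝ → ℝ, X = fun t => ∫ x, cutoff R x ^ 4 * vortSq n (u t) x := ⟨_, rfl⟩
  obtain ⟨D, hD⟩ : ∃ D : ℝ → ℝ, D = fun t => ∫ x, cutoff R x ^ 4 * vortSq (n + 1) (u t) x := ⟨_, rfl⟩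
  obtain ⟨Y, hY⟩ : ∃ Y : ℝ → ℝ, Y = fun t => ∫ x, cutoff R x ^ 2 * levelSq (n + 1) (u t) x := ⟨_, rfl⟩
  obtain ⟨Φ, hΦ⟩ : ∃ Φ : ℝ → ℝ, Φ = fun t => ∑ c', 2 * ∫ x, cutoff R x ^ 4 *
      (FluidPDE.timeDerivWithin (Icc 0 T) (fun s y => vortFam n (u s) c' y) t x *
        vortFam n (u t) c' x) := ⟨_, rfl⟩
  have cX : ContinuousOn X (Icc 0 T) := by
    rw [hX]; exact h.continuousOn_integral_cutoff_pow_mul_vortSq_forced hT hR0 4 n (by norm_num)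
  have cD : ContinuousOn D (Icc 0 T) := by
    rw [hD]; exact h.continuousOn_integral_cutoff_pow_mul_vortSq_forced hT hR0 4 (n + 1) (by norm_num)
  have cY : ContinuousOn Y (Icc 0 T) := by
    rw [hY]; exact h.continuousOn_integral_cutoff_pow_mul_levelSq_forced hT hR0 2 (n + 1) (by norm_num)
  have cΦ : ContinuousOn Φ (Icc 0 T) := by
    rw [hΦ]
    exact continuousOn_finsetSum _ fun c' _ =>
      (h.continuousOn_integral_cutoff_pow_mul_timeDerivWithin_mul_forced hT hR0 n c').const_smul
        (2 : ℝ) |>.congr fun t _ => by simp [smul_eq_mul]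
  have hX0' : ∀ t, 0 ≤ X t := fun t => by
    rw [hX]; exact integral_nonneg fun x =>
      mul_nonneg (pow_nonneg (cutoff_nonneg _ _) 4) (vortSq_nonneg _ _ _)
  have hD0' : ∀ t, 0 ≤ D t := fun t => by
    rw [hD]; exact integral_nonneg fun x =>
      mul_nonneg (pow_nonneg (cutoff_nonneg _ _) 4) (vortSq_nonneg _ _ _)
  have hY0' : ∀ t, 0 ≤ Y t := fun t => by
    rw [hY]; exact integral_nonneg fun x => mul_nonneg (sq_nonneg _) (levelSq_nonneg _ _ _)
  -- the slice inequality and the time identity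
  have hSEI : ∀ τ ∈ Icc 0 T, Φ τ ≤ -ν * D τ + C₀ * (1 + X τ + Y τ) := fun τ hτ => by
    rw [hΦ, hD, hX, hY]
    exact hC₀ R hR τ hτ (fun m hm => (hPS m hm τ hτ).1) (fun m hm => (hPS m hm τ hτ).2)
      (hPF τ hτ).1 (hPF τ hτ).2
  have hFTC : ∀ t ∈ Icc 0 T, X t - X 0 = ∫ τ in Ioo 0 t, Φ τ := fun t ht => by
    rw [hX, hΦ]; exact h.integral_cutoff_vortSq_sub_eq_forced hT hR0 n ht
  -- integrate the slice inequality
  have hY_le : ∀ t ∈ Icc 0 T, ∫ τ in Ioo 0 t, Y τ ≤ I := fun t ht => by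
    refine le_trans (setIntegral_mono_set (integrableOn_Ioo_of_continuousOn cY ⟨hT.le, le_rfl⟩)
      (ae_of_all _ fun τ => hY0' τ) (ae_of_all _ (Ioo_subset_Ioo le_rfl ht.2))) ?_
    rw [hY]; exact hPI R hR
  have hmain : ∀ t ∈ Icc 0 T, X t + ν * ∫ τ in Ioo 0 t, D τ ≤ A + C₀ * ∫ τ in Ioo 0 t, X τ := by
    intro t ht
    have iΦ := integrableOn_Ioo_of_continuousOn cΦ ht
    have iX := integrableOn_Ioo_of_continuousOn cX ht
    have iD := integrableOn_Ioo_of_continuousOn cD ht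
    have iY := integrableOn_Ioo_of_continuousOn cY ht
    have i1 : IntegrableOn (fun _ => (1 : ℝ)) (Ioo 0 t) :=
      integrableOn_const (by rw [Real.volume_Ioo]; exact ENNReal.ofReal_ne_top)
    have i1X : IntegrableOn (fun τ => 1 + X τ) (Ioo 0 t) := i1.add iX
    have iXY : IntegrableOn (fun τ => 1 + X τ + Y τ) (Ioo 0 t) := i1X.add iY
    have iC : IntegrableOn (fun τ => C₀ * (1 + X τ + Y τ)) (Ioo 0 t) := iXY.const_mul _
    have iνD : IntegrableOn (fun τ => -ν * D τ) (Ioo 0 t) := iD.const_mul _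
    have iR : IntegrableOn (fun τ => -ν * D τ + C₀ * (1 + X τ + Y τ)) (Ioo 0 t) := iνD.add iC
    have hmono : ∫ τ in Ioo 0 t, Φ τ ≤ ∫ τ in Ioo 0 t, (-ν * D τ + C₀ * (1 + X τ + Y τ)) :=
      setIntegral_mono_on iΦ iR measurableSet_Ioo fun τ hτ =>
        hSEI τ ⟨hτ.1.le, hτ.2.le.trans ht.2⟩
    have e : ∫ τ in Ioo 0 t, (-ν * D τ + C₀ * (1 + X τ + Y τ)) =
        -ν * (∫ τ in Ioo 0 t, D τ) + C₀ * (t + (∫ τ in Ioo 0 t, X τ) + ∫ τ in Ioo 0 t, Y τ) := by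
      rw [integral_add iνD iC, integral_const_mul, integral_const_mul, integral_add i1X iY,
        integral_add i1 iX, setIntegral_const, Real.volume_real_Ioo, sub_zero, max_eq_left ht.1,
        smul_eq_mul, mul_one]
    have h1 := hFTC t ht
    have h2 := hY_le t ht
    have h3 : X 0 ≤ X₀ := by rw [hX]; exact hX₀ R hR
    have h4 : C₀ * t ≤ C₀ * T := mul_le_mul_of_nonneg_left ht.2 hC₀0
    rw [hA]
    nlinarith [mul_le_mul_of_nonneg_left h2 hC₀0]
  -- Grönwall
  have hG : ∀ t ∈ Icc 0 T, X t ≤ A * Real.exp (C₀ * t) := by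
    refine le_mul_exp_of_le_add_mul_integral cX hC₀0 fun t ht => ?_
    rw [intervalIntegral.integral_of_le ht.1, integral_Ioc_eq_integral_Ioo]
    have := hmain t ht
    have hD_int : 0 ≤ ∫ τ in Ioo 0 t, D τ := setIntegral_nonneg measurableSet_Ioo fun τ _ => hD0' τ
    nlinarith [mul_nonneg hν.le hD_int]
  have hXM : ∀ t ∈ Icc 0 T, X t ≤ M₁ := fun t ht =>
    (hG t ht).trans (mul_le_mul_of_nonneg_left (Real.exp_le_exp.2
      (mul_le_mul_of_nonneg_left ht.2 hC₀0)) hA0)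
  -- the dissipation
  have hTT : T ∈ Icc 0 T := ⟨hT.le, le_rfl⟩
  have hXint : ∫ τ in Ioo 0 T, X τ ≤ T * M₁ := by
    have iX := integrableOn_Ioo_of_continuousOn cX hTT
    have i1 : IntegrableOn (fun _ => M₁) (Ioo 0 T) :=
      integrableOn_const (by rw [Real.volume_Ioo]; exact ENNReal.ofReal_ne_top)
    calc ∫ τ in Ioo 0 T, X τ ≤ ∫ _ in Ioo 0 T, M₁ :=
          setIntegral_mono_on iX i1 measurableSet_Ioo fun τ hτ => hXM τ ⟨hτ.1.le, hτ.2.le⟩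
      _ = T * M₁ := by
          rw [setIntegral_const, Real.volume_real_Ioo, sub_zero, max_eq_left hT.le, smul_eq_mul]
  have hDM : ∫ τ in Ioo 0 T, D τ ≤ (A + C₀ * (T * M₁)) / ν := by
    rw [le_div_iff₀ hν]
    have := hmain T hTT
    nlinarith [hX0' T, mul_le_mul_of_nonneg_left hXint hC₀0]
  refine ⟨fun t ht => ?_, ?_⟩
  · have := hXM t ht
    rw [hX] at this
    exact this.trans (le_max_left _ _)
  · rw [hD] at hDM
    exact hDM.trans (le_max_right _ _)

/-- **The weighted div–curl inequality along a classical solution** (any force): for `R ≥ 1`,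
`t ∈ [0, T]` and every `m`, `∫ χ_R⁴ |∇^{m+1}u(t)|² ≤ ∫ χ_R⁴ |∇ᵐΩ(t)|² + 48 c² ∫ χ_R² |∇ᵐu(t)|²`.
[folklore] -/
private theorem IsClassicalNSSolutionOn.integral_cutoff_levelSq_succ_le_forced
    (h : IsClassicalNSSolutionOn (Icc 0 T) ν f u p) {c : ℝ}
    (hc : ∀ R : ℝ, 1 ≤ R → ∀ (l : Fin 3) (x : EuclideanSpace ℝ (Fin 3)),
      |pderiv l (cutoff (E := (EuclideanSpace ℝ (Fin 3))) R) x| ≤ c) {R : ℝ}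
    (hR : 1 ≤ R) {t : ℝ} (ht : t ∈ Icc 0 T) (m : ℕ) :
    ∫ x, cutoff R x ^ 4 * levelSq (m + 1) (u t) x ≤
      (∫ x, cutoff R x ^ 4 * vortSq m (u t) x) +
        48 * c ^ 2 * ∫ x, cutoff R x ^ 2 * levelSq m (u t) x := by
  have hR0 : 0 < R := by linarith
  have := integral_pow_four_mul_levelSq_succ_le (h.contDiff_velocity ht)
    (h.sum_pderiv_comp_eq_zero ht) (contDiff_cutoff (E := (EuclideanSpace ℝ (Fin 3))) R)
    (hasCompactSupport_cutoff (E := (EuclideanSpace ℝ (Fin 3))) hR0) (cutoff_nonneg R) (hc R hR) m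
  rw [Fintype.card_fin] at this
  push_cast at this
  linarith

/-- **Exhaustion, `sup_t` half** (any force). If `∫ χ_R⁴ |∇ⁿΩ(t)|² ≤ M` for all `R ≥ 1` and
`∫ |∇ⁿu(t)|² ≤ Sₙ`, then `|∇^{n+1}u(t)|²` is integrable with `∫ |∇^{n+1}u(t)|² ≤ M + 48 c² Sₙ`.
[folklore] -/
private theorem IsClassicalNSSolutionOn.integrable_levelSq_succ_of_uniform_forced
    (h : IsClassicalNSSolutionOn (Icc 0 T) ν f u p) {c : ℝ}
    (hc : ∀ R : ℝ, 1 ≤ R → ∀ (l : Fin 3) (x : EuclideanSpace ℝ (Fin 3)),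
      |pderiv l (cutoff (E := (EuclideanSpace ℝ (Fin 3))) R) x| ≤ c) {n : ℕ} {t : ℝ}
    (ht : t ∈ Icc 0 T) {M Sn : ℝ} (hM0 : 0 ≤ M)
    (hM : ∀ R : ℝ, 1 ≤ R → ∫ x, cutoff R x ^ 4 * vortSq n (u t) x ≤ M)
    (hSi : Integrable (levelSq n (u t))) (hSle : ∫ x, levelSq n (u t) x ≤ Sn) :
    Integrable (levelSq (n + 1) (u t)) ∧ ∫ x, levelSq (n + 1) (u t) x ≤ M + 48 * c ^ 2 * Sn := by
  have hv := h.contDiff_velocity ht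
  have hSn0 : 0 ≤ Sn := (integral_nonneg (levelSq_nonneg n (u t))).trans hSle
  have hloc : ∀ R, 1 ≤ R → ∫ x, cutoff R x ^ (3 + 1) * levelSq (n + 1) (u t) x ≤
      M + 48 * c ^ 2 * Sn + 0 / R := by
    intro R hR
    have hR0 : 0 < R := by linarith
    rw [zero_div, add_zero]
    refine (h.integral_cutoff_levelSq_succ_le_forced hc hR ht n).trans (add_le_add (hM R hR)
      (mul_le_mul_of_nonneg_left ?_ (by positivity)))
    exact (integral_pow_mul_le_integral (continuous_levelSq hv n) (levelSq_nonneg n _)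
      hSi (contDiff_cutoff (E := (EuclideanSpace ℝ (Fin 3))) R)
      (hasCompactSupport_cutoff (E := (EuclideanSpace ℝ (Fin 3))) hR0) (cutoff_nonneg R)
      (cutoff_le_one R) two_ne_zero).trans hSle
  have hlin := lintegral_ofReal_le_of_forall_integral_cutoff_pow_mul_le (continuous_levelSq hv _)
    (levelSq_nonneg _ _) 3 hloc
  exact integrable_and_integral_le_of_lintegral_ofReal_le (continuous_levelSq hv _)
    (levelSq_nonneg _ _) (by positivity) hlin

/-- **Exhaustion, `L²_t` half** (any force). If `∫₀ᵀ∫ χ_R⁴ |∇^{n+1}Ω|² ≤ M` and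
`∫₀ᵀ∫ χ_R² |∇^{n+1}u|² ≤ I` for all `R ≥ 1`, then `∫₀ᵀ∫ χ_R² |∇^{n+2}u|² ≤ M + 48 c² I` for all
`R ≥ 1`. [folklore] -/
private theorem IsClassicalNSSolutionOn.integral_Ioo_cutoff_levelSq_le_of_uniform_forced
    (h : IsClassicalNSSolutionOn (Icc 0 T) ν f u p) (hT : 0 < T) {c : ℝ}
    (hc : ∀ R : ℝ, 1 ≤ R → ∀ (l : Fin 3) (x : EuclideanSpace ℝ (Fin 3)),
      |pderiv l (cutoff (E := (EuclideanSpace ℝ (Fin 3))) R) x| ≤ c) {n : ℕ} {M I : ℝ}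
    (hM : ∀ R : ℝ, 1 ≤ R → ∫ τ in Ioo 0 T, ∫ x, cutoff R x ^ 4 * vortSq (n + 1) (u τ) x ≤ M)
    (hI : ∀ R : ℝ, 1 ≤ R → ∫ τ in Ioo 0 T, ∫ x, cutoff R x ^ 2 * levelSq (n + 1) (u τ) x ≤ I)
    {R : ℝ} (hR : 1 ≤ R) :
    ∫ τ in Ioo 0 T, ∫ x, cutoff R x ^ 2 * levelSq (n + 2) (u τ) x ≤ M + 48 * c ^ 2 * I := by
  have hR0 : 0 < R := by linarith
  have h2R : 1 ≤ 2 * R := by linarith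
  have h2R0 : 0 < 2 * R := by linarith
  have hTT : T ∈ Icc 0 T := ⟨hT.le, le_rfl⟩
  have cA := h.continuousOn_integral_cutoff_pow_mul_levelSq_forced hT hR0 2 (n + 2) two_ne_zero
  have cA' := h.continuousOn_integral_cutoff_pow_mul_levelSq_forced hT h2R0 4 (n + 2) (by norm_num)
  have cD := h.continuousOn_integral_cutoff_pow_mul_vortSq_forced hT h2R0 4 (n + 1) (by norm_num)
  have cY := h.continuousOn_integral_cutoff_pow_mul_levelSq_forced hT h2R0 2 (n + 1) two_ne_zero
  have iA := integrableOn_Ioo_of_continuousOn cA hTT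
  have iA' := integrableOn_Ioo_of_continuousOn cA' hTT
  have iD := integrableOn_Ioo_of_continuousOn cD hTT
  have iY := integrableOn_Ioo_of_continuousOn cY hTT
  have iY' : IntegrableOn (fun τ => 48 * c ^ 2 *
      ∫ x, cutoff (2 * R) x ^ 2 * levelSq (n + 1) (u τ) x) (Ioo 0 T) := iY.const_mul (48 * c ^ 2)
  have iS : IntegrableOn (fun τ => (∫ x, cutoff (2 * R) x ^ 4 * vortSq (n + 1) (u τ) x) +
      48 * c ^ 2 * ∫ x, cutoff (2 * R) x ^ 2 * levelSq (n + 1) (u τ) x) (Ioo 0 T) := iD.add iY'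
  have step1 : ∫ τ in Ioo 0 T, ∫ x, cutoff R x ^ 2 * levelSq (n + 2) (u τ) x ≤
      ∫ τ in Ioo 0 T, ∫ x, cutoff (2 * R) x ^ 4 * levelSq (n + 2) (u τ) x := by
    refine setIntegral_mono_on iA iA' measurableSet_Ioo fun τ hτ => ?_
    have hv := h.contDiff_velocity ⟨hτ.1.le, hτ.2.le⟩
    exact integral_mono (integrable_cutoff_pow_mul (continuous_levelSq hv (n + 2)) hR0 two_ne_zero)
      (integrable_cutoff_pow_mul (continuous_levelSq hv (n + 2)) h2R0 (by norm_num))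
      fun x => mul_le_mul_of_nonneg_right (cutoff_sq_le_cutoff_two_mul_pow_four hR0 x)
        (levelSq_nonneg _ _ x)
  have step2 : ∫ τ in Ioo 0 T, ∫ x, cutoff (2 * R) x ^ 4 * levelSq (n + 2) (u τ) x ≤
      ∫ τ in Ioo 0 T, ((∫ x, cutoff (2 * R) x ^ 4 * vortSq (n + 1) (u τ) x) +
        48 * c ^ 2 * ∫ x, cutoff (2 * R) x ^ 2 * levelSq (n + 1) (u τ) x) :=
    setIntegral_mono_on iA' iS measurableSet_Ioo fun τ hτ =>
      h.integral_cutoff_levelSq_succ_le_forced hc h2R ⟨hτ.1.le, hτ.2.le⟩ (n + 1)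
  have step3 : ∫ τ in Ioo 0 T, ((∫ x, cutoff (2 * R) x ^ 4 * vortSq (n + 1) (u τ) x) +
        48 * c ^ 2 * ∫ x, cutoff (2 * R) x ^ 2 * levelSq (n + 1) (u τ) x) =
      (∫ τ in Ioo 0 T, ∫ x, cutoff (2 * R) x ^ 4 * vortSq (n + 1) (u τ) x) +
        48 * c ^ 2 * ∫ τ in Ioo 0 T, ∫ x, cutoff (2 * R) x ^ 2 * levelSq (n + 1) (u τ) x := by
    rw [integral_add iD iY', integral_const_mul]
  have hc2 : 0 ≤ 48 * c ^ 2 := by positivity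
  calc ∫ τ in Ioo 0 T, ∫ x, cutoff R x ^ 2 * levelSq (n + 2) (u τ) x
      ≤ (∫ τ in Ioo 0 T, ∫ x, cutoff (2 * R) x ^ 4 * vortSq (n + 1) (u τ) x) +
          48 * c ^ 2 * ∫ τ in Ioo 0 T, ∫ x, cutoff (2 * R) x ^ 2 * levelSq (n + 1) (u τ) x :=
        step1.trans (step2.trans_eq step3)
    _ ≤ M + 48 * c ^ 2 * I :=
        add_le_add (hM (2 * R) h2R) (mul_le_mul_of_nonneg_left (hI (2 * R) h2R) hc2)

/-- **The induction step `X^n → X^{n+1}`, forced.** For a classical solution of the forced system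
on `[0, T] × ℝ³` with `ν > 0` and `n ≥ 1`: if `sup_t ∫ |∇ᵐu(t)|² < ∞` for `m ≤ n`, the
localised `L²_t` norms of `∇^{n+1}u` are bounded uniformly in the cutoff radius,
`|∇^{n+1}u(0)|²` is integrable and `sup_t ∫|∇^{n+1}f(t)|² < ∞`, then the same holds with `n`
replaced by `n + 1`. [cite: DoeringGibbon1995, §6.2 Thm. 6.1 with eq. (6.2.8) (p. 99)] -/
theorem IsClassicalNSSolutionOn.sobolev_step_forced
    (h : IsClassicalNSSolutionOn (Icc 0 T) ν f u p) (hν : 0 < ν) (hT : 0 < T) {n : ℕ}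
    (hn : 1 ≤ n) (hdat : Integrable (levelSq (n + 1) (u 0)))
    (hfrc : ∃ F : ℝ, ∀ t ∈ Icc 0 T,
      Integrable (levelSq (n + 1) (f t)) ∧ ∫ x, levelSq (n + 1) (f t) x ≤ F)
    (hPS : ∀ m ≤ n, ∃ S : ℝ, ∀ t ∈ Icc 0 T,
      Integrable (levelSq m (u t)) ∧ ∫ x, levelSq m (u t) x ≤ S)
    (hPI : ∃ I : ℝ, ∀ R, 1 ≤ R →
      ∫ τ in Ioo 0 T, ∫ x, cutoff R x ^ 2 * levelSq (n + 1) (u τ) x ≤ I) :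
    (∃ S : ℝ, ∀ t ∈ Icc 0 T,
        Integrable (levelSq (n + 1) (u t)) ∧ ∫ x, levelSq (n + 1) (u t) x ≤ S) ∧
      ∃ I : ℝ, ∀ R, 1 ≤ R →
        ∫ τ in Ioo 0 T, ∫ x, cutoff R x ^ 2 * levelSq (n + 2) (u τ) x ≤ I := by
  -- uniform nonnegative constants
  choose! Sf hSf using hPS
  obtain ⟨S, hSdef⟩ : ∃ S : ℕ → ℝ, S = fun m => max (Sf m) 0 := ⟨_, rfl⟩
  have hS0 : ∀ m, 0 ≤ S m := fun m => by rw [hSdef]; exact le_max_right _ _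
  have hS : ∀ m ≤ n, ∀ t ∈ Icc 0 T,
      Integrable (levelSq m (u t)) ∧ ∫ x, levelSq m (u t) x ≤ S m := fun m hm t ht =>
    ⟨(hSf m hm t ht).1, (hSf m hm t ht).2.trans (by rw [hSdef]; exact le_max_left _ _)⟩
  obtain ⟨F₀, hF₀⟩ := hfrc
  have hF : ∀ t ∈ Icc 0 T,
      Integrable (levelSq (n + 1) (f t)) ∧ ∫ x, levelSq (n + 1) (f t) x ≤ max F₀ 0 :=
    fun t ht => ⟨(hF₀ t ht).1, (hF₀ t ht).2.trans (le_max_left _ _)⟩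
  obtain ⟨I, hI⟩ := hPI
  obtain ⟨c, hc0, hc⟩ := exists_abs_pderiv_cutoff_le
  have h0T : (0 : ℝ) ∈ Icc 0 T := ⟨le_rfl, hT.le⟩
  have hu0 : ContDiff ℝ ∞ (u 0) := h.contDiff_velocity h0T
  -- the initial localised vorticity energy
  have hvort0 : Integrable (vortSq n (u 0)) := by
    refine (hdat.const_mul 4).mono' (continuous_vortSq hu0 n).aestronglyMeasurable
      (Eventually.of_forall fun x => ?_)
    rw [Real.norm_of_nonneg (vortSq_nonneg n _ x)]
    exact vortSq_le_four_mul_levelSq_succ hu0 n x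
  have hX₀ : ∀ R, 1 ≤ R →
      ∫ x, cutoff R x ^ 4 * vortSq n (u 0) x ≤ 4 * ∫ x, levelSq (n + 1) (u 0) x := by
    intro R hR
    have hR0 : 0 < R := by linarith
    calc ∫ x, cutoff R x ^ 4 * vortSq n (u 0) x ≤ ∫ x, vortSq n (u 0) x :=
          integral_pow_mul_le_integral (continuous_vortSq hu0 n) (vortSq_nonneg n _) hvort0
            (contDiff_cutoff (E := (EuclideanSpace ℝ (Fin 3))) R)
            (hasCompactSupport_cutoff (E := (EuclideanSpace ℝ (Fin 3))) hR0)
            (cutoff_nonneg R) (cutoff_le_one R) (by norm_num)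
      _ ≤ ∫ x, 4 * levelSq (n + 1) (u 0) x :=
          integral_mono hvort0 (hdat.const_mul 4) fun x => vortSq_le_four_mul_levelSq_succ hu0 n x
      _ = 4 * ∫ x, levelSq (n + 1) (u 0) x := integral_const_mul _ _
  -- Grönwall
  obtain ⟨M, hM⟩ := h.uniform_enstrophy_bounds_forced hν hT hn S hS0 hS (le_max_right _ _) hF hI hX₀
  have hM0 : 0 ≤ M := le_trans (integral_nonneg fun x =>
    mul_nonneg (pow_nonneg (cutoff_nonneg _ _) 4) (vortSq_nonneg _ _ _)) ((hM 1 le_rfl).1 0 h0T)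
  refine ⟨⟨M + 48 * c ^ 2 * S n, fun t ht => ?_⟩, ⟨M + 48 * c ^ 2 * I, fun R hR => ?_⟩⟩
  · exact h.integrable_levelSq_succ_of_uniform_forced hc ht hM0 (fun R hR => (hM R hR).1 t ht)
      (hS n le_rfl t ht).1 (hS n le_rfl t ht).2
  · exact h.integral_Ioo_cutoff_levelSq_le_of_uniform_forced hT hc (fun R' hR' => (hM R' hR').2) hI hR

/-- **The base case, `sup_t` half** (any force): the `L^∞_t H¹_x` part of `X¹` bounds
`∫ |∇ᵐu(t)|²`, `m ≤ 1`, uniformly on `[0, T]` (constants `3^{m+1}`). [folklore] -/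
private theorem IsClassicalNSSolutionOn.sobolev_base_sup_forced
    (h : IsClassicalNSSolutionOn (Icc 0 T) ν f u p) (hX : FluidPDE.MemSobolevX 1 T u) {m : ℕ}
    (hm : m ≤ 1) :
    ∃ S : ℝ, ∀ t ∈ Icc 0 T, Integrable (levelSq m (u t)) ∧ ∫ x, levelSq m (u t) x ≤ S := by
  obtain ⟨C, hC⟩ := hX.1 m hm
  refine ⟨3 ^ (m + 1) * (C : ℝ), fun t ht => ?_⟩
  have hv := h.contDiff_velocity ht
  have hfin : ∫⁻ x, ‖iteratedFDeriv ℝ m (u t) x‖ₑ ^ 2 < ⊤ := (hC t ht).trans_lt ENNReal.coe_lt_top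
  obtain ⟨hint, hle⟩ := integrable_levelSq_of_lintegral_lt_top hv m hfin
  refine ⟨hint, hle.trans (mul_le_mul_of_nonneg_left ?_ (by positivity))⟩
  have := ENNReal.toReal_mono ENNReal.coe_ne_top (hC t ht)
  simpa using this

/-- **The base case, `L²_t` half** (any force): the `L²_t H²_x` part of `X¹` bounds
`∫₀ᵀ ∫ χ_R² |∇²u|²` uniformly in `R`. [folklore] -/
private theorem IsClassicalNSSolutionOn.sobolev_base_int_forced
    (h : IsClassicalNSSolutionOn (Icc 0 T) ν f u p) (hT : 0 < T) (hX : FluidPDE.MemSobolevX 1 T u)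
    {R : ℝ} (hR : 1 ≤ R) :
    ∫ τ in Ioo 0 T, ∫ x, cutoff R x ^ 2 * levelSq 2 (u τ) x ≤
      (ENNReal.ofReal (3 ^ (2 + 1)) *
        ∫⁻ t in Ioo 0 T, ∫⁻ x, ‖iteratedFDeriv ℝ 2 (u t) x‖ₑ ^ 2).toReal := by
  have hJtop : (∫⁻ t in Ioo 0 T, ∫⁻ x, ‖iteratedFDeriv ℝ 2 (u t) x‖ₑ ^ 2) < ⊤ := hX.2
  have h27J : ENNReal.ofReal (3 ^ (2 + 1)) *
      (∫⁻ t in Ioo 0 T, ∫⁻ x, ‖iteratedFDeriv ℝ 2 (u t) x‖ₑ ^ 2) ≠ ⊤ :=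
    ENNReal.mul_ne_top ENNReal.ofReal_ne_top hJtop.ne
  have hR0 : 0 < R := by linarith
  have hTT : T ∈ Icc 0 T := ⟨hT.le, le_rfl⟩
  have cY := h.continuousOn_integral_cutoff_pow_mul_levelSq_forced hT hR0 2 2 two_ne_zero
  have iY := integrableOn_Ioo_of_continuousOn cY hTT
  have hY0 : ∀ τ, 0 ≤ ∫ x, cutoff R x ^ 2 * levelSq 2 (u τ) x := fun τ =>
    integral_nonneg fun x => mul_nonneg (sq_nonneg _) (levelSq_nonneg _ _ _)
  rw [← ENNReal.ofReal_le_iff_le_toReal h27J, ofReal_integral_eq_lintegral_ofReal iY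
    (ae_of_all _ hY0), ← lintegral_const_mul' _ _ ENNReal.ofReal_ne_top]
  refine setLIntegral_mono' measurableSet_Ioo fun τ hτ => ?_
  exact ofReal_integral_cutoff_sq_mul_levelSq_le (h.contDiff_velocity ⟨hτ.1.le, hτ.2.le⟩) hR0 2

/-- **The base case** (any force): membership in `X¹([0, T] × ℝ³)` (`MemSobolevX 1`) gives the
level-`1` hypotheses of `sobolev_step_forced`. [folklore] -/
private theorem IsClassicalNSSolutionOn.sobolev_base_forced
    (h : IsClassicalNSSolutionOn (Icc 0 T) ν f u p) (hT : 0 < T) (hX : FluidPDE.MemSobolevX 1 T u) :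
    (∀ m ≤ 1, ∃ S : ℝ, ∀ t ∈ Icc 0 T,
        Integrable (levelSq m (u t)) ∧ ∫ x, levelSq m (u t) x ≤ S) ∧
      ∃ I : ℝ, ∀ R, 1 ≤ R →
        ∫ τ in Ioo 0 T, ∫ x, cutoff R x ^ 2 * levelSq 2 (u τ) x ≤ I :=
  ⟨fun _ hm => h.sobolev_base_sup_forced hX hm, ⟨_, fun _ hR => h.sobolev_base_int_forced hT hX hR⟩⟩

/-- **All levels, forced.** For a classical solution of the forced system on `[0, T] × ℝ³`
(`ν > 0`) in `X¹([0, T] × ℝ³)` whose datum has all `|∇ᵐu(0)|²` integrable and whose force has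
`sup_{t ∈ [0,T]} ∫ |∇ᵐf(t)|² < ∞` for every `m`, every level `n ≥ 1` of the induction holds; in
particular `sup_{t ∈ [0,T]} ∫ |∇ᵐ u(t)|² < ∞` for every `m`. [cite: Tao2011, Cor. 4.3 + Thm. 5.4 (iv) (arXiv Cor. 26, Thm. 31 (iv)), proof via the energy method] -/
theorem IsClassicalNSSolutionOn.sobolev_all_forced
    (h : IsClassicalNSSolutionOn (Icc 0 T) ν f u p) (hν : 0 < ν) (hT : 0 < T)
    (hX : FluidPDE.MemSobolevX 1 T u) (hdat : ∀ m, Integrable (levelSq m (u 0)))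
    (hfrc : ∀ m, ∃ F : ℝ, ∀ t ∈ Icc 0 T,
      Integrable (levelSq m (f t)) ∧ ∫ x, levelSq m (f t) x ≤ F)
    (n : ℕ) (hn : 1 ≤ n) :
    (∀ m ≤ n, ∃ S : ℝ, ∀ t ∈ Icc 0 T,
        Integrable (levelSq m (u t)) ∧ ∫ x, levelSq m (u t) x ≤ S) ∧
      ∃ I : ℝ, ∀ R, 1 ≤ R →
        ∫ τ in Ioo 0 T, ∫ x, cutoff R x ^ 2 * levelSq (n + 1) (u τ) x ≤ I := by
  induction n, hn using Nat.le_induction with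
  | base => exact h.sobolev_base_forced hT hX
  | succ n hn ih =>
      obtain ⟨hS, hI⟩ := h.sobolev_step_forced hν hT hn (hdat (n + 1)) (hfrc (n + 1)) ih.1 ih.2
      refine ⟨fun m hm => ?_, hI⟩
      rcases Nat.lt_or_ge m (n + 1) with hm' | hm'
      · exact ih.1 m (Nat.lt_succ_iff.1 hm')
      · have : m = n + 1 := le_antisymm hm hm'
        subst this
        exact hS

/-! ## §4 Persistence of regularity for classical solutions of the forced system in `X¹` -/

/-- **Tao 2013, Cor. 4.3 + Thm. 5.4 (iv) with the closing note of its proof, WITH FORCE, for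
classical solutions in `X¹` — a theorem.** Let `ν > 0`, `T > 0`, and let `(u, p)` be a classical
solution of the forced Navier–Stokes system on `[0, T] × ℝ³` (force `f`) lying in
`X¹([0,T] × ℝ³) = L^∞_t H¹_x ∩ L²_t H²_x` (`MemSobolevX 1 T u`), whose datum has
`∫ ‖Dᵐu(0)‖² < ∞` for every `m` and whose force has `sup_{t ∈ [0,T]} ∫ ‖Dᵐf(t)‖² < ∞` for every
`m` (a smooth `L^∞_t H^k_x` force for all `k`, as in the note closing the proof of Thm. 5.4:
"it would have sufficed to have `u₀ ∈ H^k_x` and `f ∈ C^j_t H^k_x` for all `j, k`"). Then all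
spatial Sobolev norms of `u` are bounded on `[0, T]`: `u ∈ L^∞_t H^k_x([0,T] × ℝ³)` for every `k`
(`HasBoundedSobolevNormsOn (Icc 0 T) u`). Printed proof: mild formulation, Cor. 4.3, Thm. 5.4;
proof here: the classical vorticity energy method WITH the curl of the force (§1–§3), the forced
twin of the tree's `tao2011_hasBoundedSobolevNormsOn_of_memSobolevX_holds`.
[cite: Tao2011, Cor. 4.3 + Thm. 5.4 (iv) (arXiv Cor. 26, Thm. 31 (iv) with the closing note of its proof)] -/
theorem IsClassicalNSSolutionOn.hasBoundedSobolevNormsOn_forced_of_memSobolevX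
    (h : IsClassicalNSSolutionOn (Icc 0 T) ν f u p) (hν : 0 < ν) (hT : 0 < T)
    (hX : FluidPDE.MemSobolevX 1 T u)
    (h₀ : ∀ m : ℕ, ∫⁻ x, ‖iteratedFDeriv ℝ m (u 0) x‖ₑ ^ 2 < ⊤)
    (hf : ∀ m : ℕ, ∃ C : ℝ≥0, ∀ t ∈ Icc 0 T, ∫⁻ x, ‖iteratedFDeriv ℝ m (f t) x‖ₑ ^ 2 ≤ C) :
    HasBoundedSobolevNormsOn (Icc 0 T) u := by
  have h0T : (0 : ℝ) ∈ Icc 0 T := ⟨le_rfl, hT.le⟩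
  have hU := uniqueDiffOn_Icc hT
  have hu0 : ContDiff ℝ ∞ (u 0) := h.contDiff_velocity h0T
  have hdat : ∀ m, Integrable (levelSq m (u 0)) := fun m =>
    (integrable_levelSq_of_lintegral_lt_top hu0 m (h₀ m)).1
  have hfrc : ∀ m, ∃ F : ℝ, ∀ t ∈ Icc 0 T,
      Integrable (levelSq m (f t)) ∧ ∫ x, levelSq m (f t) x ≤ F := by
    intro m
    obtain ⟨C, hC⟩ := hf m
    refine ⟨3 ^ (m + 1) * (C : ℝ), fun t ht => ?_⟩
    have hg : ContDiff ℝ ∞ (f t) := h.contDiff_force hU ht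
    have hfin : ∫⁻ x, ‖iteratedFDeriv ℝ m (f t) x‖ₑ ^ 2 < ⊤ := (hC t ht).trans_lt ENNReal.coe_lt_top
    obtain ⟨hint, hle⟩ := integrable_levelSq_of_lintegral_lt_top hg m hfin
    refine ⟨hint, hle.trans (mul_le_mul_of_nonneg_left ?_ (by positivity))⟩
    have := ENNReal.toReal_mono ENNReal.coe_ne_top (hC t ht)
    simpa using this
  intro k
  -- level `max k 1 ≥ k`
  obtain ⟨hS, -⟩ := h.sobolev_all_forced hν hT hX hdat hfrc (max k 1) (le_max_right _ _)
  obtain ⟨S, hSk⟩ := hS k (le_max_left _ _)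
  refine ⟨(3 ^ (k + 1) * S).toNNReal, fun t ht => ?_⟩
  have hv := h.contDiff_velocity ht
  refine (lintegral_sq_norm_iteratedFDeriv_le hv k (hSk t ht).1).trans ?_
  change ENNReal.ofReal _ ≤ ENNReal.ofReal _
  exact ENNReal.ofReal_le_ofReal (mul_le_mul_of_nonneg_left (hSk t ht).2 (by positivity))

end Solution

/-! ## §5 Clay-class forces: slice Sobolev bounds of all orders and the spatial clause of
`tao2011_hasBoundedSobolevNormsOn_forced` -/

section SliceWithin

variable {E : Type*} [NormedAddCommGroup E] [InnerProductSpace ℝ E]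
  {F : Type*} [NormedAddCommGroup F] [NormedSpace ℝ F]

/-- **Slice derivatives of all orders are bounded by the joint within-derivatives on the
half-space.** For `f` smooth on `[0, ∞) × E`, `t ≥ 0` and every order `m`,
`‖Dᵐ(f t)(x)‖ ≤ ‖Dᵐ_{(t,x)}(uncurry f)|_{[0,∞) × E}(t, x)‖` (chain rule with the affine embedding
`y ↦ (t, y)`, whose linear part `inr` has norm `≤ 1`). [cite: Tao2011, §1 p. 3] -/
theorem IsSmoothOnHalfSpace.norm_iteratedFDeriv_slice_le {f : ℝ → E → F}
    (hf : IsSmoothOnHalfSpace f) (m : ℕ) {t : ℝ} (ht : 0 ≤ t) (x : E) :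
    ‖iteratedFDeriv ℝ m (f t) x‖ ≤
      ‖iteratedFDerivWithin ℝ m (uncurry f) (Ici (0 : ℝ) ×ˢ univ) (t, x)‖ := by
  set s : Set (ℝ × E) := Ici (0 : ℝ) ×ˢ univ with hs
  set a : ℝ × E := (t, 0) with ha
  set s' : Set (ℝ × E) := Ici (-t) ×ˢ univ with hs'
  set G : ℝ × E → F := fun z => uncurry f (a + z) with hG
  have has : a +ᵥ s' = s := by
    ext z
    rw [Set.mem_vadd_set]
    constructor
    · rintro ⟨w, hw, rfl⟩
      simp only [hs', hs, mem_prod, mem_Ici, mem_univ, and_true] at hw ⊢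
      simp only [ha, vadd_eq_add, Prod.fst_add]
      linarith
    · intro hz
      refine ⟨z - a, ?_, by simp⟩
      simp only [hs', hs, mem_prod, mem_Ici, mem_univ, and_true] at hz ⊢
      simp only [ha, Prod.fst_sub]
      linarith
  have hmaps : MapsTo (fun z : ℝ × E => a + z) s' s := by
    intro z hz
    rw [← has]
    exact ⟨z, hz, rfl⟩
  have hGs : ContDiffOn ℝ ∞ G s' :=
    hf.comp (contDiff_const.add contDiff_id).contDiffOn hmaps
  have hUs' : UniqueDiffOn ℝ s' := (uniqueDiffOn_Ici _).prod uniqueDiffOn_univ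
  set L : E →L[ℝ] ℝ × E := ContinuousLinearMap.inr ℝ ℝ E with hL
  have hmem : ∀ y : E, L y ∈ s' := fun y => by
    simp only [hL, ContinuousLinearMap.inr_apply, hs', mem_prod, mem_Ici, mem_univ, and_true]
    linarith
  have hpre : L ⁻¹' s' = univ := Set.eq_univ_of_forall fun y => hmem y
  have key := ContinuousLinearMap.iteratedFDerivWithin_comp_right (𝕜 := ℝ) L hGs hUs'
    (by rw [hpre]; exact uniqueDiffOn_univ) (hmem x) (i := m) (by exact_mod_cast le_top)
  have hslice : f t = G ∘ L := by
    funext y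
    simp [hG, hL, ha, uncurry]
  have hGF : iteratedFDerivWithin ℝ m G s' (L x) = iteratedFDerivWithin ℝ m (uncurry f) s (t, x) := by
    rw [hG, iteratedFDerivWithin_comp_add_left, has]
    congr 1
    simp [hL, ha]
  calc ‖iteratedFDeriv ℝ m (f t) x‖
      = ‖iteratedFDerivWithin ℝ m (G ∘ L) (L ⁻¹' s') x‖ := by
        rw [hpre, iteratedFDerivWithin_univ, hslice]
    _ = ‖(iteratedFDerivWithin ℝ m G s' (L x)).compContinuousLinearMap fun _ => L‖ := by rw [key]
    _ ≤ ‖iteratedFDerivWithin ℝ m G s' (L x)‖ * ∏ _i : Fin m, ‖L‖ :=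
        ContinuousMultilinearMap.norm_compContinuousLinearMap_le _ _
    _ ≤ ‖iteratedFDerivWithin ℝ m G s' (L x)‖ :=
        mul_le_of_le_one_right (norm_nonneg _)
          (Finset.prod_le_one (fun _ _ => ContinuousLinearMap.opNorm_nonneg L)
            fun _ _ => ContinuousLinearMap.norm_inr_le_one ℝ ℝ E)
    _ = _ := by rw [hGF]

end SliceWithin

section ClaySlices

variable {E : Type*} [NormedAddCommGroup E] [InnerProductSpace ℝ E] [FiniteDimensional ℝ E]
  [MeasurableSpace E] [BorelSpace E] {μ : Measure E} [μ.IsAddHaarMeasure]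
  {F : Type*} [NormedAddCommGroup F] [NormedSpace ℝ F]

omit [InnerProductSpace ℝ E] [FiniteDimensional ℝ E] [BorelSpace E] [μ.IsAddHaarMeasure]
  [NormedSpace ℝ F] in
/-- A pointwise bound `‖g x‖ ≤ C (1 + ‖x‖)^{-K}` gives `∫ ‖g‖² ≤ C² ∫ (1 + ‖x‖)^{-(K+K)}`
(file-internal plumbing, copied from `TaoForcedUniquenessSchwartzForce`). [folklore] -/
private theorem lintegral_enorm_sq_le_of_norm_le_mul_rpow' {g : E → F} {C : ℝ} {K : ℕ}
    (hg : ∀ x, ‖g x‖ ≤ C * (1 + ‖x‖) ^ (-(K : ℝ))) :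
    ∫⁻ x, ‖g x‖ₑ ^ 2 ∂μ ≤
      ENNReal.ofReal (C ^ 2) * ∫⁻ x, ENNReal.ofReal ((1 + ‖x‖) ^ (-((K : ℝ) + K))) ∂μ := by
  have hpt : ∀ x : E, ‖g x‖ₑ ^ 2 ≤
      ENNReal.ofReal (C ^ 2) * ENNReal.ofReal ((1 + ‖x‖) ^ (-((K : ℝ) + K))) := by
    intro x
    have h2 : ‖g x‖ ^ 2 ≤ C ^ 2 * (1 + ‖x‖) ^ (-((K : ℝ) + K)) := by
      calc ‖g x‖ ^ 2 ≤ (C * (1 + ‖x‖) ^ (-(K : ℝ))) ^ 2 :=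
            pow_le_pow_left₀ (norm_nonneg _) (hg x) 2
        _ = C ^ 2 * ((1 + ‖x‖) ^ (-(K : ℝ)) * (1 + ‖x‖) ^ (-(K : ℝ))) := by ring
        _ = C ^ 2 * (1 + ‖x‖) ^ (-((K : ℝ) + K)) := by rw [rpow_neg_mul_rpow_neg]
    rw [← ofReal_norm, ← ENNReal.ofReal_pow (norm_nonneg _), ← ENNReal.ofReal_mul (sq_nonneg _)]
    exact ENNReal.ofReal_le_ofReal h2
  calc ∫⁻ x, ‖g x‖ₑ ^ 2 ∂μ
      ≤ ∫⁻ x, ENNReal.ofReal (C ^ 2) * ENNReal.ofReal ((1 + ‖x‖) ^ (-((K : ℝ) + K))) ∂μ :=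
        lintegral_mono hpt
    _ = ENNReal.ofReal (C ^ 2) * ∫⁻ x, ENNReal.ofReal ((1 + ‖x‖) ^ (-((K : ℝ) + K))) ∂μ :=
        lintegral_const_mul' _ _ ENNReal.ofReal_ne_top

/-- **"Schwartz forcing is `L^∞_t H^k_x` for every `k`"** (Tao 2011, §1, p. 3, for Fefferman's
class (5)): a force smooth on `[0, ∞) × E` with the space-time decay (5) has `‖Dᵐf(t)‖_{L²}`
bounded uniformly in `t ≥ 0` for EVERY order `m` — the all-orders extension of the tree's
`HasRapidSpaceTimeDecay.exists_lintegral_iteratedFDeriv_slice_sq_le` (`m ≤ 1`), via the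
all-orders slice bound `IsSmoothOnHalfSpace.norm_iteratedFDeriv_slice_le` (weight
`K = dim E + 1`, Mathlib `finite_integral_one_add_norm`). [cite: Tao2011, §1 p. 3] -/
theorem HasRapidSpaceTimeDecay.exists_lintegral_iteratedFDeriv_slice_sq_le_all {f : ℝ → E → F}
    (hs : IsSmoothOnHalfSpace f) (hf : HasRapidSpaceTimeDecay f) (m : ℕ) :
    ∃ C : ℝ≥0, ∀ t, 0 ≤ t → ∫⁻ x, ‖iteratedFDeriv ℝ m (f t) x‖ₑ ^ 2 ∂μ ≤ C := by
  have hd : HasUniformRapidDecayOn (Ici (0 : ℝ)) f := hf.hasUniformRapidDecayOn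
  set K : ℕ := Module.finrank ℝ E + 1 with hK
  have hr : (Module.finrank ℝ E : ℝ) < (K : ℝ) + K := by
    rw [hK]; push_cast; linarith [(Module.finrank ℝ E).cast_nonneg (α := ℝ)]
  set I : ℝ≥0∞ := ∫⁻ x, ENNReal.ofReal ((1 + ‖x‖) ^ (-((K : ℝ) + K))) ∂μ with hI
  have hItop : I < ⊤ := finite_integral_one_add_norm hr
  obtain ⟨C, -, hC⟩ := hd.norm_iteratedFDerivWithin_le_rpow m K
  have hB : ENNReal.ofReal (C ^ 2) * I < ⊤ := ENNReal.mul_lt_top ENNReal.ofReal_lt_top hItop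
  refine ⟨(ENNReal.ofReal (C ^ 2) * I).toNNReal, fun t ht => ?_⟩
  rw [ENNReal.coe_toNNReal hB.ne]
  have hg : ∀ x, ‖iteratedFDeriv ℝ m (f t) x‖ ≤ C * (1 + ‖x‖) ^ (-(K : ℝ)) := fun x =>
    (hs.norm_iteratedFDeriv_slice_le m ht x).trans (hC t (mem_Ici.mpr ht) x)
  exact lintegral_enorm_sq_le_of_norm_le_mul_rpow' hg

end ClaySlices

section Clay

variable {T ν : ℝ} {f u : ℝ → EuclideanSpace ℝ (Fin 3) → EuclideanSpace ℝ (Fin 3)}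
  {p : ℝ → EuclideanSpace ℝ (Fin 3) → ℝ}

/-- **Tao 2013, Cor. 11.1 + Cor. 4.3 + Thm. 5.4 (iv) WITH a Clay-class force — the SPATIAL clause,
a theorem.** Let `ν > 0`, `T > 0`, and let `(u, p)` be a classical solution of the forced
Navier–Stokes system on the CLOSED slab `[0, T] × ℝ³` with finite energy
`sup_{t ∈ [0,T]} ∫|u(t)|² < ∞`, Schwartz datum `u 0` (`HasRapidSpatialDecay`) and a Clay-class
force (`C^∞` on `[0,∞) × ℝ³` with Fefferman's space–time decay (5)). Then
`u ∈ L^∞_t H^k_x([0,T] × ℝ³)` for every `k` (`HasBoundedSobolevNormsOn (Icc 0 T) u`). Chain, every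
link a theorem of the tree: Lemma 8.1 and Prop. 9.1 WITH force give finite dissipation and finite
total speed (`dissipation_lt_top_of_clayForce`, `totalSpeed_lt_top_of_clayForce`, seat lean2 with
lit g8/g9's corrected forced Lemma 4.1 (i)); Cor. 11.1 WITH force puts `u` in `X¹`
(`memSobolevX_one_forced_of_totalSpeed`); persistence of regularity WITH force (§4) gives all
orders. This is the first of the three clauses of the named fact
`tao2011_hasBoundedSobolevNormsOn_forced` (`TaoForcedBoundedSobolevNorms.lean`), obtained WITHOUT
its pressure-normalisation hypothesis (the vorticity method never sees the pressure); the `∂ₜu`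
and `p` clauses, which do depend on the normalisation, are not treated here.
[cite: Tao2011, Cor. 11.1 + Cor. 4.3 + Thm. 5.4 (iv) (arXiv Cor. 68, Cor. 26, Thm. 31 (iv))] -/
theorem IsClassicalNSSolutionOn.hasBoundedSobolevNormsOn_of_clayForce
    (hsol : IsClassicalNSSolutionOn (Icc 0 T) ν f u p) (hν : 0 < ν) (hT : 0 < T)
    (hE : ∃ C : ℝ≥0, ∀ t ∈ Icc 0 T, ∫⁻ x, ‖u t x‖ₑ ^ 2 ≤ C)
    (h₀ : HasRapidSpatialDecay (u 0))
    (hfs : IsSmoothOnHalfSpace f) (hfd : HasRapidSpaceTimeDecay f) :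
    HasBoundedSobolevNormsOn (Icc 0 T) u := by
  -- the datum: all orders in `L²`
  have h₀' : ∀ m : ℕ, ∫⁻ x, ‖iteratedFDeriv ℝ m (u 0) x‖ₑ ^ 2 < ⊤ := fun m =>
    h₀.lintegral_enorm_iteratedFDeriv_sq_lt_top m
  -- the force: all orders, uniformly on the slab
  have hf' : ∀ m : ℕ, ∃ C : ℝ≥0, ∀ t ∈ Icc 0 T, ∫⁻ x, ‖iteratedFDeriv ℝ m (f t) x‖ₑ ^ 2 ≤ C :=
    fun m => by
      obtain ⟨C, hC⟩ := hfd.exists_lintegral_iteratedFDeriv_slice_sq_le_all (μ := volume) hfs m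
      exact ⟨C, fun t ht => hC t ht.1⟩
  -- the energy in the `ℝ≥0∞` rendering of the Clay-force lemmas
  have hE' : ∃ A : ℝ≥0∞, A < ⊤ ∧ ∀ t ∈ Icc 0 T, ∫⁻ x, ‖u t x‖ₑ ^ 2 ≤ A := by
    obtain ⟨C, hC⟩ := hE
    exact ⟨C, ENNReal.coe_lt_top, hC⟩
  -- Cor. 11.1 WITH force: `u ∈ X¹`
  have hX : FluidPDE.MemSobolevX 1 T u :=
    hsol.memSobolevX_one_forced_of_totalSpeed hν hT (fun j _ => hf' j) (h₀' 1) hE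
      (hsol.dissipation_lt_top_of_clayForce hν hT hfs hfd hE')
      (hsol.totalSpeed_lt_top_of_clayForce hν hT hfs hfd hE')
  exact hsol.hasBoundedSobolevNormsOn_forced_of_memSobolevX hν hT hX h₀' hf'

end Clay

end Literature.Analysis.FluidPDE

end
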